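import Literature.MathematicalPhysics.QuantumFieldTheory.BalabanImbrieJaffe1984to88.BIJ88Decay241FlatTorus
import Literature.MathematicalPhysics.QuantumFieldTheory.BalabanImbrieJaffe1984to88.BIJ85Ineq732BackgroundStab
import Literature.MathematicalPhysics.QuantumFieldTheory.BalabanImbrieJaffe1984to88.BIJ88NeumannPropagatorWholeTorus
import Literature.MathematicalPhysics.QuantumFieldTheory.BalabanImbrieJaffe1984to88.BIJ85CoefficientAk464
import Literature.MathematicalPhysics.QuantumFieldTheory.BalabanImbrieJaffe1984to88.BIJ88DeltaRegionSmallField236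

/-!
# `BalabanImbrieJaffe1984to88.BIJ88Decay241SmallFieldTorus` — T. Bałaban, J. Imbrie, A. Jaffe, *Effective action and cluster properties of
the abelian Higgs model*, Commun. Math. Phys. **114** (1988) 257–315 [BalabanImbrieJaffe1988], §2 (2.38)/(2.41) p. 264 [PDF 8]: **THE
SINGLE-SCALE PROPAGATOR `[(Δ_k(u) + aL^{−2}Q^*Q)|_Λ]^{−1}` DECAYS EXPONENTIALLY, `|C^{(k)}_Λ(u;x₁,x₂)| ≦ ce^{−c|x₁−x₂|}`, AT SMALL NON-FLAT
BACKGROUNDS ON THE TORUS** — the FIRST NON-FLAT member of this seat's (2.41) lane: p. 264 *"by (2.38), C^{(k)}_Λ(u)^{−1} is bounded below and a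
random walk expansion as in [6] can be used to prove (2.41)"* made a theorem AT THE SMALL FIELDS `u = Q^{s*}_kv·e^{iθ}` OF [I] (4.5.4) AND ALL THEIR GAUGE TRANSFORMS `u^h` (v1.1 §5),
with its two inputs BY NAME — the non-flat (2.38)-shape lower bound = [I] (7.3.2) WITH ITS FIELD-STRENGTH TERM (p33's `BIJ85Ineq732BackgroundStab.ineq732_background_phys`,
read on gen 15's matrix `Δ_k(T,u)` through gen 16's dictionary `BIJ88NeumannPropagatorWholeTorus.inner_deltaOp_eq`) and the non-flat locality (2.36)
(gen 19's `BIJ88DeltaRegionSmallField236.decay236_torus_smallField_level`, p27's [6] (1.10) at small plaquette fields) — the Poincaré step being p33's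
`BIJ85BlockKPoincare.sum_norm_sq_le_cov` WITH its smallness terms, and the ENGINE [6] = [Balaban1983RegularityDecay] Sect. 5 (5.7) AS KERNEL-PROVED IN
THE TREE (gen 19's `BIJ88Decay241FlatTorus.norm_inv_apply_le`: finite Combes–Thomas for Re-coercive complex matrices).

statement-level skeleton of published theorems with citation tags; proofs where landed; nothing here is a claim about the Yang–Mills mass gap

PDF held: `paper:balaban1988-cmp114-bij-abelian-higgs-effective-action` (journal page = PDF page + 256; p. 264 = PDF 8, text layer `lit read … --pages 7-9`
re-read this session; ×2 render `HOME/lit-balaban-p31/renders/original-p008-x2.png`).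

CITATION HEADER (lean-in-tree rule).  lit-balaban cell (HOME `run/shared/lean/pub/lit-balaban/`), Phase 2, seat p31 gen 19 (unit `lit-balaban-p31`,
literature-prover-lit-balaban-p31-g19-0), free-target protocol G.5-34(d), TAKING line HOME/STATUS.md 2026-08-22T21:55:18Z (stem check: no non-flat
(2.41)/(2.38)-for-`Δ_k(T,u)` file or TAKING by another seat; courtesy notices to r18 (owner) and p33).  Rows of `HOME/lit-balaban-r18/ROWS-C2.md` (owner
r18, referee ref-5): **C2.Eq2.41** (typed `BIJ88Sect2Statements.Decay` p239939, head p02 g3's `BIJ88Decay241Walks.abs_C_le_exp`; flat located members gen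
19's `BIJ88Decay241FlatTorus`) — here the first NON-FLAT located member; **C2.Eq2.38** (head p02's `BIJ88Ineq238Proof`; flat torus members this seat's
`BIJ88Ineq238FlatTorus`, p29's `BIJ88Ineq238FlatCwtTorus`) — here the first NON-FLAT torus member (for `Δ_k(T,u)`, `Ω = T`).  Cells only; heads unchanged.
Files USED BY NAME, nothing restated: p33's `BIJ85Ineq732BackgroundStab.ineq732_background_phys`, `BIJ85Ineq732Background.bg454`,
`BIJ85Ineq732Flat` (`bondForm`, `cPhys`, `cPhys_pos`, `cPhys_sq`), `BIJ85BlockKPoincare.sum_norm_sq_le_cov`; p11's `BIJ85ScalarPropagatorTorus.FineSp`/`Dlin`,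
`BIJ85ScalarForm464` (`opT`, `deltaOp`), `BIJ85BlockAveragesTorusK` (`QlinK`, `qCovK`, `blkIter`, `holCK`), r15's `BIJ85Sect4Statements.aK`, p33/r14's
`BIJ85CoefficientAk464` (`aK_eq_aSeq`, `aK_pos_le`); gen 16's `BIJ88NeumannPropagatorWholeTorus` (`gLin`, `opT_gLin`, `inner_deltaOp_eq`); gen 15's
`BIJ88DeltaLoc234Torus.deltaRegion`, `BIJ88NeumannPropagator227Torus` (`nOp`, `nOp_eq`, `dN`, `gBox`, `gBox_univ_mul`), `BIJ88Vj5610Operator.dMat`; gen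
18's `BIJ88Eq240FlatTorus` (`pOp`, `op240`, `re_form_op240`, `c240`, `compress`, `ext0`, `star_dotProduct_compress`, `isUnit_compress_of_re_pos`); gen 19's
`BIJ88Decay241FlatTorus` (`norm_inv_apply_le`, `norm_op240_apply_le`, `one_le_ratio`, `c240_smul`) and `BIJ88DeltaRegionSmallField236.decay236_torus_smallField_level`;
p38's `B5Ineq137Torus` (`T`, `T_symm`, `T_self`, `T_triangle`, `rowSum_T_le`); pv09's `B4Sect5Torus` (`IsPseudoDist`, `SumBound`, `weightC`); pv23's
`B4Sect5Proof.latticeConst(_nonneg)`; pv07's `B1RG242Torus.α`/`one_lt_cast_L`, `B1.aSeq_pos`/`aSeq_le`; p27's `BIJ85AbelianStokes.plaqC`.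

## The print (verbatim, p. 264)

*"Finally, in view of (2.35), the lower bound (I.7.3.2) applies to Δ_{k,loc}(u) as well. Let φ be supported in a region having an r(e_k)
neighborhood where u is smooth. Then ⟨φ, Δ_{k,loc}(u)φ⟩ ≥ c₁Σ_b|u(b)φ(b₊) − φ(b₋)|² − ce_k²p(e_k)²Σ_x|φ(x)|². (2.38) … We define C^{(k)}_Λ(u) =
[(Δ_{k,loc}(u) + aL^{−2}Q(u)*Q(u))|_Λ]^{−1}. (2.40) This is of course a nonlocal operator, but by (2.38), C^{(k)}_Λ(u)^{−1} is bounded below and a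
random walk expansion as in [6] can be used to prove that |C^{(k)}_Λ(u; x₁, x₂)| ≦ ce^{−c|x₁−x₂|}. (2.41)"* — [I] = [BalabanImbrieJaffe1985] (7.3.2)
p. 326 (second printed form, with the unit-lattice variables `v_b`); [I] (4.5.4) pp. 312–313: the background `u = (Q^{s*}_kv)·e^{iθ}`; [6] = T. Bałaban, CMP
**89** (1983), Sect. 5 Theorem p. 594 (5.6) ⟹ (5.7).

## The mechanism and what is proved (theorems only; 0 definitions; 0 `sorry`; no `Prop`-valued fact; standard axioms)

* §1 THE p. 264 LOWER BOUND AT A SMALL FIELD: `sum_norm_sq_le_smallField` (p33's `k`-block Poincaré coercivity at `k = 1` WITH the smallness terms: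
  `(1 − (2(L−1)L·d·T² + 2δ²))‖φ‖² ≤ 2(L−1)L·Σ_b|u(b)φ(b₊)−φ(b₋)|² + 2L^d‖Q(u)φ‖²` for `|u(b) − 1| ≤ T` inside the blocks, holonomy deviation `≤ δ`);
  **`lowerBound_op240_smallField`**: the PRINTED (2.38)-shape bound `γΣ_b|u(b)φ(b₊)−φ(b₋)|² − E‖φ‖² ≤ Re φᴴΔφ` on the fields supported in `Λ` and
  `2(L−1)L·d·T² + 2δ² ≤ σ` give `(c₀(γ,κ)(1 − σ) − E)‖φ‖² ≤ Re φᴴ(Δ + κP(u))φ` (`c₀ =` gen 18's `c240`); `re_form_op240_smallField_pos`,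
  `isUnit_compress_op240_smallField` ((2.40): `C^{(k)}_Λ(u)` EXISTS at a small field, any `Λ`).
* §2 **`decay241_smallField`** — (2.41) AT A SMALL FIELD FOR ANY COMPLEX `Δ` with the printed (2.38)-shape bound (`E < c₀(γ,κ)(1 − σ)`) and the
  (2.36)-shape kernel bound `‖Δ(x₁,x₂)‖ ≤ c_Δe^{−δ₀|x₁−x₂|}` on `Λ × Λ`: for every rate `0 ≤ θ ≤ δ₀/4` with
  `θ·(c_Δ + κL^{−2d}e^{δ₀(L−1)})(4/δ₀)·2K_d(δ₀/2) ≤ (c₀(γ,κ)(1−σ) − E)/2`, **`‖C^{(k)}_Λ(u;x₁,x₂)‖ ≤ (4/(c₀(γ,κ)(1−σ) − E))·e^{−θ|x₁−x₂|_{T^{(k)}}}`**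
  uniformly in the torus and `Λ` (`re_coercive_compress_smallField`; engine gen 19's `norm_inv_apply_le`).
* §3 THE NON-FLAT (2.38)-SHAPE FOR `Δ_k(T,u)`: `gBox_univ_smul` / **`deltaRegion_univ_smul`** (`Δ_k(T,u)` is homogeneous of degree two in `(√a, c)`:
  `Δ_{(s²a, sc)} = s²Δ_{(a,c)}` — whence gen 15's counting normalization `(A, ε^{−1}) = (s²a_k, s·c_phys)`, `s² = A/a_k = L^{kd}/(L^kε)²`);
  **`ineq238_deltaRegion_phys`**: `γ₀Σ_B|v(B)φ(B₊)−φ(B₋)|² − 32γ₀d(2d+1)²(L^kT)²‖φ‖² ≤ Re φᴴΔ_k(T,u)φ`, `γ₀ = min(a/(10d), ⅕)`, at `u = Q^{s*}_kv·e^{iθ}`,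
  `|θ_b| ≤ T`, `36d(2d+1)²(L^kT)² ≤ 1`, EVERY `φ` (p33's (7.3.2)-with-mass-term through gen 16's `inner_deltaOp_eq` with `G := gLin`);
  **`ineq238_deltaRegion_bg454`**: the same for gen 15's object of record `deltaRegion (α_kL^{kd}) ε^{−1} u k univ` with the factor `A/a_k`.
* §4 **`decay241_deltaRegion_smallField`** — THE LOCATED NON-FLAT MEMBER with constants chosen BEFORE the instance: for every `(d, L, a, κ̂)` with
  `1 ≤ d ≤ 3`, `L` odd `> 1` there are `τ₀, δ₁, c₂ > 0` such that for every torus, `1 ≤ k ≤ K` with a next lattice, every background `u = Q^{s*}_kv·e^{iθ}`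
  with `|θ_b| ≤ T`, `(L^kT)² ≤ τ₀`, plaquettes `|u(∂p) − 1| ≤ θ_p`, `2d³(L^{2k}θ_p)² ≤ 1`, coarse field `|v(B) − 1| ≤ T₁` inside the blocks, holonomy
  deviation `≤ δ′`, `2(L−1)L·d·T₁² + 2δ′² ≤ ½`, and EVERY `Λ ⊆ T^{(k)}`:
  **`‖[(Δ_k(T,u) + (A/a_k)κ̂Q(v)^*Q(v))|_Λ]^{−1}(x₁,x₂)‖ ≤ (a_k/A)·c₂·e^{−δ₁|x₁−x₂|_{T^{(k)}}}`**, uniformly in `ε`, the torus, `k`, `Λ`, `v`, `θ`; and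
  **`decay241_deltaRegion_smallField_printed`**: the VERBATIM shape `≤ c₂e^{−δ₁|x₁−x₂|}` (`A/a_k ≥ 1`, gen 19's `one_le_ratio`).
* §5 (v1.1) GAUGE COVARIANCE: `pOp_gaugeAct` (`P(v^g) = M_gP(v)M_gᴴ`), **`op240_deltaRegion_gaugeAct`** (`Δ_k(T,u^h) + κP(v^{h_k}) =
  M^{(k)}_h(Δ_k(T,u) + κP(v))M^{(k)}_hᴴ`, gen 15's `deltaRegion_gaugeAct`), `compress_sandwich`, `norm_inv_sandwich_apply`;
  **`decay241_deltaRegion_smallField_gaugeAct`** — the bound of §4, same constants and (gauge-invariant) hypotheses, for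
  `[(Δ_k(T,u^h) + (A/a_k)κ̂Q(v^{h_k})^*Q(v^{h_k}))|_Λ]^{−1}` at EVERY gauge transform `u^h`, `h : T_ε → U(1)` (the kernel keeps its absolute values);
  `decay241_deltaRegion_smallField_gaugeAct_printed` (the verbatim shape).
* §6 (v1.1) **`isUnit_op240_deltaRegion_smallField`** — (2.39)/(2.40) EXISTENCE of `[(Δ_k(T,u) + (A/a_k)κ̂Q(v)^*Q(v))|_Λ]^{−1}` at the small
  (4.5.4) backgrounds with `τ₀` chosen before the instance — ANY `d ≥ 1`, `L ≥ 2`, every `Λ`, no locality / plaquette input (§3 + §1).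
* §7 (v1.2) **(4.9)_{j≥1} AT SMALL NON-FLAT FIELDS** — `deltaRegion_conjTranspose` (`Δ_k(Ω,u)` is Hermitian, every `u`, every `k`-block union `Ω`);
  **`Z49_smallField_eq`** / `Z49_smallField_pos` / `log_Z49_smallField_sites`: for any HERMITIAN `Δ` with the printed (2.38)-shape bound w.r.t. a small bond
  field `u` (§1's hypotheses, `E < c₀(γ,κ)(1 − σ)`), `realify((Δ + κP(u))|_Λ)` is POSITIVE DEFINITE and r18's `Z49_eq` / `Z49_pos` / `log_Z49_sites`
  ((4.9) evaluated, positive, logarithmic form with (4.11)) hold with `T.PosDef` DISCHARGED — the non-flat twin of gen 18's `Z49_flat_eq` /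
  `log_Z49_flat_sites`; **`Z49_deltaRegion_smallField`** — THE LOCATED NON-FLAT MEMBER for gen 15's `Δ_k(T,u)` at the small (4.5.4) backgrounds
  (`τ₀` chosen before the instance; ANY `d ≥ 1`, `L ≥ 2`, every `Λ`, every `(E_s, N)`): PosDef ∧ closed form ∧ `0 < Z` (row C2.Eq4.9, `j = k ≥ 1`,
  at non-flat `u`; p34's `z49Slot_pureGauge_eq` HONEST SCOPE *"general small backgrounds: not addressed"* is this case for the region form).
HONEST SCOPE / DIVERGENCE.  (i) BACKGROUNDS: the small-field family `u = Q^{s*}_kv·e^{iθ}` of [I] (4.5.4) (p33's `bg454`; smallness of `θ`, of the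
plaquettes of `u`, and of the coarse unit-lattice field `v` inside the `L`-blocks as listed) and (§5) all its gauge transforms `u^h` with the
unit-lattice field transformed along (`v^{h_k}`) — [I]'s own parametrization of the small-field region ([I] §4.5: every field is a gauge transform of a
(4.5.4) background); that representation theorem is NOT invoked here (the hypotheses are placed on the (4.5.4) data `(v, θ)`), and the smallness is
the listed one, not the print's *"(2.32)-smooth u"* verbatim.  (ii) `Ω = T` AND NO LOCALIZATION: the
operator is the region form `Δ_k(T,u)` of (2.34)/(2.35) on the WHOLE torus, not `Δ_{k,loc}(u)`; the non-flat (2.35) error (the `ce_k²p(e_k)²` of (2.38))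
is not in the tree (the flat one is: gen 17/18), so the `E` of §4 is the (7.3.2) field-strength term `32γ₀d(2d+1)²(L^kT)²` alone; consequently no
support condition on `φ`/`Λ` is needed.  (iii) THE UNIT-LATTICE VARIABLES in `aL^{−2}Q^*Q` and in the (2.38) bond term are the `v` of (4.5.4) ([I]
(7.3.2), second printed form `Σ|v_bψ(b₊) − ψ(b₋)|²`); the straight-run phases `e^{iθ(Γ)}` (`|θ(Γ)| ≤ L^kT`) are dropped THERE (they are kept inside
`Δ_k(T,u)`).  (iv) METHOD: [6] Sect. 5 is used as kernel-proved in the tree by finite Combes–Thomas (pv23 `B4Sect5Proof`, pv09 `B4Sect5Torus`), not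
by the printed walk resummation; (2.42)–(2.45) are not constructed here.  (v) Counting normalization of gen 15 (`Δ_k(T,u)`, `κ` and `C^{−1}` carry
`A/a_k ≥ 1`; the printed `aL^{−2}` is `κ̂`), whence the factor `(a_k/A)` in §4, dropped in the `_printed` form.  (vi) Two constants `(c₂, δ₁)` for the
print's generic `c`; constants not optimized (`δ₁ ≤ δ₀/4`, `δ₀` the non-flat (2.36) rate of p27's (1.10)); `1 ≤ d ≤ 3`, `L` odd (scope of p27's
`decay110_smallField`), `m² = 0`, `1 ≤ k ≤ K`, `k + 1 ≤ m + K`.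
v1.1 (§5, §6) = v1 (p342992) verbatim + §5, §6 appended.  v1.2 (§7) = v1.1 (p343427) verbatim + §7 appended (seat p31 gen 20,
literature-prover-lit-balaban-p31-g20-0, TAKING line HOME/STATUS.md 2026-08-22T23:10:07Z; rows C2.Eq4.9 located member at non-flat `u`, owner r18).  Imports: gen 19's `BIJ88Decay241FlatTorus` and `BIJ88DeltaRegionSmallField236`, p33's `BIJ85Ineq732BackgroundStab`, gen 16's
`BIJ88NeumannPropagatorWholeTorus`, `BIJ85CoefficientAk464`.  Literature + Mathlib only.  Unit `lit-balaban-p31` (literature-prover-lit-balaban-p31-g19-0; v1.2 -g20-0),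
2026-08-22.  NOT summit progress.
-/

open scoped BigOperators Matrix ComplexConjugate
open Finset Matrix

namespace Literature.MathematicalPhysics.QuantumFieldTheory.BalabanImbrieJaffe1984to88.BIJ88Decay241SmallFieldTorus

open Literature.MathematicalPhysics.QuantumFieldTheory.Balaban1983to89
open BIJ88Sect3Statements (U1 toC)
open BIJ85BlockAveragesTorus BIJ85BlockAveragesTorusK
open BIJ88DeltaLoc234Torus (qMatT qMatT_apply deltaRegion)
open BIJ88Eq240FlatTorus
open BIJ88Decay241FlatTorus
open B4Sect5Torus (IsPseudoDist SumBound weightC)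
open GaugeField (gaugeAct)

/-! ## §1 The p. 264 lower bound *"by (2.38), C^{(k)}_Λ(u)^{−1} is bounded below"* AT A SMALL BOND FIELD `u` -/

section LowerBound

variable {P : Params} {j : ℕ}

/-- **THE POINCARÉ-TYPE INPUT OF p. 264 AT A SMALL FIELD** (the silent [I] §7 / [7] step behind *"by (2.38), C^{(k)}_Λ(u)^{−1} is bounded
below"*): on the unit lattice `T^{(k)}` (any level `j` with `j + 1 ≤ m + K`), for EVERY bond field `u` with `|u(b) − 1| ≤ T` on the bonds inside
the `L`-blocks and holonomy deviation `|u(Γ_{y,x}) − 1| ≤ δ`, and every field `φ`,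
`(1 − (2(L−1)L·d·T² + 2δ²))·Σ_x|φ(x)|² ≤ 2(L−1)L·Σ_b|u(b)φ(b₊) − φ(b₋)|² + 2L^d·Σ_y|(Q(u)φ)(y)|²` — p33's `k`-block Poincaré–Steiner
coercivity `BIJ85BlockKPoincare.sum_norm_sq_le_cov` at `k = 1` WITH its two smallness terms (gen 18's `sum_norm_sq_le_pureGauge` is the case
`T = δ = 0` at a pure gauge). [cite: BalabanImbrieJaffe1985, (7.3.2) p.326] -/
theorem sum_norm_sq_le_smallField (hj : j + 1 ≤ P.m + P.K) (U : GaugeField P j U1) {T δ : ℝ}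
    (hInt : ∀ b : PBond P j, blkIter 1 b.src = blkIter 1 b.tgt → ‖toC (U b) - 1‖ ≤ T)
    (hTree : ∀ x : Balaban1983to89.Site P j, ‖holCK U 1 x - 1‖ ≤ δ) (φ : Balaban1983to89.Site P j → ℂ) :
    (1 - (2 * (((P.L : ℝ) - 1) * P.L) * P.d * T ^ 2 + 2 * δ ^ 2)) * ∑ x, ‖φ x‖ ^ 2 ≤
      2 * (((P.L : ℝ) - 1) * P.L) * ∑ b : PBond P j, ‖toC (U b) * φ b.tgt - φ b.src‖ ^ 2
        + 2 * (P.L : ℝ) ^ P.d * ∑ y, ‖qCovK U 1 φ y‖ ^ 2 := by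
  have h := BIJ85BlockKPoincare.sum_norm_sq_le_cov (k := 1) hj U hInt hTree φ
  simp only [pow_one, one_mul] at h
  exact h

/-- **THE LOWER BOUND OF p. 264 AT A SMALL FIELD** (*"by (2.38), C^{(k)}_Λ(u)^{−1} is bounded below"*): if a complex operator `Δ` on
`ℓ²(T^{(k)})` satisfies the PRINTED (2.38)-shape bound `γ·Σ_b|u(b)φ(b₊) − φ(b₋)|² − E·‖φ‖² ≤ Re φᴴΔφ` for every `φ` supported in `Λ`, at a bond
field `u` with `|u(b) − 1| ≤ T` inside the blocks and holonomy deviation `≤ δ`, and `2(L−1)L·d·T² + 2δ² ≤ σ`, then for those `φ`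
`(c₀(γ,κ)(1 − σ) − E)·‖φ‖² ≤ Re φᴴ(Δ + κP(u))φ` (`c₀ =` gen 18's `c240`). [cite: BalabanImbrieJaffe1988, (2.40) p.264] -/
theorem lowerBound_op240_smallField (hj : j + 1 ≤ P.m + P.K) (U : GaugeField P j U1) {T δ σ : ℝ}
    (hInt : ∀ b : PBond P j, blkIter 1 b.src = blkIter 1 b.tgt → ‖toC (U b) - 1‖ ≤ T)
    (hTree : ∀ x : Balaban1983to89.Site P j, ‖holCK U 1 x - 1‖ ≤ δ)
    (hσ : 2 * (((P.L : ℝ) - 1) * P.L) * P.d * T ^ 2 + 2 * δ ^ 2 ≤ σ)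
    {Δ : Matrix (Balaban1983to89.Site P j) (Balaban1983to89.Site P j) ℂ} {Λ : Finset (Balaban1983to89.Site P j)} {γ E κ : ℝ}
    (hγ : 0 ≤ γ) (hκ : 0 ≤ κ)
    (h238 : ∀ φ : Balaban1983to89.Site P j → ℂ, (∀ x ∉ Λ, φ x = 0) →
      γ * ∑ b : PBond P j, ‖toC (U b) * φ b.tgt - φ b.src‖ ^ 2 - E * ∑ x, ‖φ x‖ ^ 2 ≤ (star φ ⬝ᵥ (Δ *ᵥ φ)).re)
    (φ : Balaban1983to89.Site P j → ℂ) (hφ : ∀ x ∉ Λ, φ x = 0) :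
    (c240 P γ κ * (1 - σ) - E) * ∑ x, ‖φ x‖ ^ 2 ≤ (star φ ⬝ᵥ (op240 Δ κ U *ᵥ φ)).re := by
  have hL2 : 2 ≤ P.L := P.hL.2
  have hL : (2 : ℝ) ≤ P.L := by exact_mod_cast hL2
  have hA : (0 : ℝ) < 2 * (((P.L : ℝ) - 1) * P.L) := by nlinarith
  have hB : (0 : ℝ) < 2 * (P.L : ℝ) ^ P.d := by positivity
  obtain ⟨Bf, hBf⟩ : ∃ x, x = ∑ b : PBond P j, ‖toC (U b) * φ b.tgt - φ b.src‖ ^ 2 := ⟨_, rfl⟩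
  obtain ⟨Qf, hQf⟩ : ∃ x, x = ∑ y, ‖qCovK U 1 φ y‖ ^ 2 := ⟨_, rfl⟩
  obtain ⟨N2, hN2⟩ : ∃ x, x = ∑ x, ‖φ x‖ ^ 2 := ⟨_, rfl⟩
  have hBf0 : 0 ≤ Bf := by rw [hBf]; positivity
  have hQf0 : 0 ≤ Qf := by rw [hQf]; positivity
  have hN0 : 0 ≤ N2 := by rw [hN2]; positivity
  have hP := sum_norm_sq_le_smallField hj U hInt hTree φ
  rw [← hBf, ← hQf, ← hN2] at hP
  rw [re_form_op240, ← hQf, ← hN2]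
  have h1 := h238 φ hφ
  rw [← hBf, ← hN2] at h1
  have hc1 : c240 P γ κ ≤ γ / (2 * (((P.L : ℝ) - 1) * P.L)) := min_le_left _ _
  have hc2 : c240 P γ κ ≤ κ / (2 * (P.L : ℝ) ^ P.d) := min_le_right _ _
  have hc0 : 0 ≤ c240 P γ κ := le_min (div_nonneg hγ hA.le) (div_nonneg hκ hB.le)
  have hσ' : (1 - σ) * N2 ≤ (1 - (2 * (((P.L : ℝ) - 1) * P.L) * P.d * T ^ 2 + 2 * δ ^ 2)) * N2 :=
    mul_le_mul_of_nonneg_right (by linarith) hN0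
  have key : c240 P γ κ * ((1 - σ) * N2) ≤ γ * Bf + κ * Qf := by
    calc c240 P γ κ * ((1 - σ) * N2) ≤ c240 P γ κ * (2 * (((P.L : ℝ) - 1) * P.L) * Bf + 2 * (P.L : ℝ) ^ P.d * Qf) :=
          mul_le_mul_of_nonneg_left (hσ'.trans hP) hc0
      _ = c240 P γ κ * (2 * (((P.L : ℝ) - 1) * P.L)) * Bf + c240 P γ κ * (2 * (P.L : ℝ) ^ P.d) * Qf := by ring
      _ ≤ γ / (2 * (((P.L : ℝ) - 1) * P.L)) * (2 * (((P.L : ℝ) - 1) * P.L)) * Bf + κ / (2 * (P.L : ℝ) ^ P.d) * (2 * (P.L : ℝ) ^ P.d) * Qf :=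
          add_le_add (mul_le_mul_of_nonneg_right (mul_le_mul_of_nonneg_right hc1 hA.le) hBf0)
            (mul_le_mul_of_nonneg_right (mul_le_mul_of_nonneg_right hc2 hB.le) hQf0)
      _ = γ * Bf + κ * Qf := by rw [div_mul_cancel₀ _ hA.ne', div_mul_cancel₀ _ hB.ne']
  have e : (c240 P γ κ * (1 - σ) - E) * N2 = c240 P γ κ * ((1 - σ) * N2) - E * N2 := by ring
  rw [e]
  linarith

/-- **Strict positivity at a small field**: with `E < c₀(γ,κ)(1 − σ)` the form of `Δ + κP(u)` is STRICTLY positive on the nonzero fields supported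
in `Λ`. [cite: BalabanImbrieJaffe1988, (2.40) p.264] -/
theorem re_form_op240_smallField_pos (hj : j + 1 ≤ P.m + P.K) (U : GaugeField P j U1) {T δ σ : ℝ}
    (hInt : ∀ b : PBond P j, blkIter 1 b.src = blkIter 1 b.tgt → ‖toC (U b) - 1‖ ≤ T)
    (hTree : ∀ x : Balaban1983to89.Site P j, ‖holCK U 1 x - 1‖ ≤ δ)
    (hσ : 2 * (((P.L : ℝ) - 1) * P.L) * P.d * T ^ 2 + 2 * δ ^ 2 ≤ σ)
    {Δ : Matrix (Balaban1983to89.Site P j) (Balaban1983to89.Site P j) ℂ} {Λ : Finset (Balaban1983to89.Site P j)} {γ E κ : ℝ}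
    (hγ : 0 ≤ γ) (hκ : 0 ≤ κ) (hE : E < c240 P γ κ * (1 - σ))
    (h238 : ∀ φ : Balaban1983to89.Site P j → ℂ, (∀ x ∉ Λ, φ x = 0) →
      γ * ∑ b : PBond P j, ‖toC (U b) * φ b.tgt - φ b.src‖ ^ 2 - E * ∑ x, ‖φ x‖ ^ 2 ≤ (star φ ⬝ᵥ (Δ *ᵥ φ)).re)
    {φ : Balaban1983to89.Site P j → ℂ} (hφ : ∀ x ∉ Λ, φ x = 0) (hne : φ ≠ 0) :
    0 < (star φ ⬝ᵥ (op240 Δ κ U *ᵥ φ)).re := by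
  have h := lowerBound_op240_smallField hj U hInt hTree hσ hγ hκ h238 φ hφ
  have hpos : 0 < ∑ x, ‖φ x‖ ^ 2 := by
    obtain ⟨x, hx⟩ : ∃ x, φ x ≠ 0 := by
      by_contra hh; push Not at hh; exact hne (funext hh)
    exact lt_of_lt_of_le (by positivity : 0 < ‖φ x‖ ^ 2) (single_le_sum (f := fun x => ‖φ x‖ ^ 2) (fun _ _ => by positivity) (mem_univ x))
  nlinarith

/-- **(2.39)/(2.40) AT A SMALL FIELD: `C^{(k)}_Λ(u) = [(Δ + κQ(u)^*Q(u))|_Λ]^{−1}` EXISTS** — the compressed operator is invertible on `ℓ²(Λ)`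
(any `Λ`; strict positivity of the real part of its form). [cite: BalabanImbrieJaffe1988, (2.40) p.264] -/
theorem isUnit_compress_op240_smallField (hj : j + 1 ≤ P.m + P.K) (U : GaugeField P j U1) {T δ σ : ℝ}
    (hInt : ∀ b : PBond P j, blkIter 1 b.src = blkIter 1 b.tgt → ‖toC (U b) - 1‖ ≤ T)
    (hTree : ∀ x : Balaban1983to89.Site P j, ‖holCK U 1 x - 1‖ ≤ δ)
    (hσ : 2 * (((P.L : ℝ) - 1) * P.L) * P.d * T ^ 2 + 2 * δ ^ 2 ≤ σ)
    {Δ : Matrix (Balaban1983to89.Site P j) (Balaban1983to89.Site P j) ℂ} {Λ : Finset (Balaban1983to89.Site P j)} {γ E κ : ℝ}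
    (hγ : 0 ≤ γ) (hκ : 0 ≤ κ) (hE : E < c240 P γ κ * (1 - σ))
    (h238 : ∀ φ : Balaban1983to89.Site P j → ℂ, (∀ x ∉ Λ, φ x = 0) →
      γ * ∑ b : PBond P j, ‖toC (U b) * φ b.tgt - φ b.src‖ ^ 2 - E * ∑ x, ‖φ x‖ ^ 2 ≤ (star φ ⬝ᵥ (Δ *ᵥ φ)).re) :
    IsUnit (compress Λ (op240 Δ κ U)) :=
  isUnit_compress_of_re_pos fun _ hφ hne => re_form_op240_smallField_pos hj U hInt hTree hσ hγ hκ hE h238 hφ hne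

end LowerBound

/-! ## §2 **(2.41) AT A SMALL FIELD for any complex `Δ` with the printed (2.38)-shape bound and an exponentially localised kernel on `Λ`** -/

section Decay

variable {P : Params} {j : ℕ}

/-- kernel: `Σ_x ‖(ext v)(x)‖² = Σ_{i∈Λ} ‖v_i‖²`. [folklore] -/
private theorem sum_norm_sq_ext0 {S : Type*} [Fintype S] [DecidableEq S] (Λ : Finset S) (v : ↥Λ → ℂ) :
    ∑ x, ‖ext0 Λ v x‖ ^ 2 = ∑ i : ↥Λ, ‖v i‖ ^ 2 := by
  have h1 : ∑ x, ‖ext0 Λ v x‖ ^ 2 = ∑ x ∈ Λ, ‖ext0 Λ v x‖ ^ 2 :=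
    (Finset.sum_subset (Finset.subset_univ Λ) fun x _ hx => by
      rw [ext0_of_not_mem v hx, norm_zero, zero_pow two_ne_zero]).symm
  rw [h1, ← Finset.sum_coe_sort Λ]
  exact Finset.sum_congr rfl fun i _ => by rw [ext0_coe]

/-- kernel: the sup torus distance is a pseudo-distance (p38's `T_symm`/`T_self`/`T_triangle`). [folklore] -/
private theorem isPseudoDist_T (P : Params) (j : ℕ) : IsPseudoDist (B5Ineq137Torus.T P j) :=
  ⟨B5Ineq137Torus.T_symm P j, B5Ineq137Torus.T_self P j, B5Ineq137Torus.T_triangle P j⟩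

/-- kernel: the exponential row sums of the torus are bounded by pv23's `K_d` uniformly in the torus (p38's `rowSum_T_le`). [folklore] -/
private theorem sumBound_T (P : Params) (j : ℕ) : SumBound (B5Ineq137Torus.T P j) (B4Sect5Proof.latticeConst P.d) :=
  fun _ ha x => B5Ineq137Torus.rowSum_T_le P j ha x

/-- **The form of `(Δ + κP(u))|_Λ` is coercive on `ℓ²(Λ)` at a small field**: `(c₀(γ,κ)(1 − σ) − E)·Σ_{i∈Λ}‖v_i‖² ≤ Re vᴴ(Δ + κP(u))|_Λv`.
[cite: BalabanImbrieJaffe1988, (2.40) p.264] -/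
theorem re_coercive_compress_smallField (hj : j + 1 ≤ P.m + P.K) (U : GaugeField P j U1) {T δ σ : ℝ}
    (hInt : ∀ b : PBond P j, blkIter 1 b.src = blkIter 1 b.tgt → ‖toC (U b) - 1‖ ≤ T)
    (hTree : ∀ x : Balaban1983to89.Site P j, ‖holCK U 1 x - 1‖ ≤ δ)
    (hσ : 2 * (((P.L : ℝ) - 1) * P.L) * P.d * T ^ 2 + 2 * δ ^ 2 ≤ σ)
    {Δ : Matrix (Balaban1983to89.Site P j) (Balaban1983to89.Site P j) ℂ} {Λ : Finset (Balaban1983to89.Site P j)} {γ E κ : ℝ}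
    (hγ : 0 ≤ γ) (hκ : 0 ≤ κ)
    (h238 : ∀ φ : Balaban1983to89.Site P j → ℂ, (∀ x ∉ Λ, φ x = 0) →
      γ * ∑ b : PBond P j, ‖toC (U b) * φ b.tgt - φ b.src‖ ^ 2 - E * ∑ x, ‖φ x‖ ^ 2 ≤ (star φ ⬝ᵥ (Δ *ᵥ φ)).re)
    (v : ↥Λ → ℂ) :
    (c240 P γ κ * (1 - σ) - E) * ∑ i, ‖v i‖ ^ 2 ≤ (star v ⬝ᵥ (compress Λ (op240 Δ κ U) *ᵥ v)).re := by
  rw [star_dotProduct_compress, ← sum_norm_sq_ext0 Λ v]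
  exact lowerBound_op240_smallField hj U hInt hTree hσ hγ hκ h238 (ext0 Λ v) (fun x hx => ext0_of_not_mem v hx)

/-- **(2.41) AT A SMALL (NON-FLAT) FIELD, for any complex `Δ`** (*"This is of course a nonlocal operator, but by (2.38), C^{(k)}_Λ(u)^{−1} is
bounded below and a random walk expansion as in [6] can be used to prove that |C^{(k)}_Λ(u; x₁, x₂)| ≦ ce^{−c|x₁−x₂|}. (2.41)"*, p. 264): on
`T^{(k)}` (any level with a next one), let the bond field `u` satisfy `|u(b) − 1| ≤ T` on the bonds inside the `L`-blocks and have holonomy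
deviation `≤ δ`, `2(L−1)L·d·T² + 2δ² ≤ σ`; let `Δ` satisfy the PRINTED (2.38)-shape bound `γΣ_b|u(b)φ(b₊)−φ(b₋)|² − E‖φ‖² ≤ Re φᴴΔφ` on the
fields supported in `Λ` with `E < c₀(γ,κ)(1 − σ)`, and the (2.36)-shape kernel bound `‖Δ(x₁,x₂)‖ ≤ c_Δe^{−δ₀|x₁−x₂|_{T^{(k)}}}` on `Λ × Λ`. Then for
every rate `0 ≤ θ ≤ δ₀/4` with `θ·(c_Δ + κL^{−2d}e^{δ₀(L−1)})(4/δ₀)·2K_d(δ₀/2) ≤ (c₀(γ,κ)(1 − σ) − E)/2`,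
`‖C^{(k)}_Λ(u;x₁,x₂)‖ ≤ (4/(c₀(γ,κ)(1 − σ) − E))·e^{−θ|x₁−x₂|_{T^{(k)}}}` for `C^{(k)}_Λ(u) = [(Δ + κQ(u)^*Q(u))|_Λ]^{−1}`, uniformly in the torus
and in `Λ` — gen 19's `decay241_flat` with the flat Poincaré step replaced by the small-field one; engine `norm_inv_apply_le` ([6] Sect. 5 as
kernel-proved in the tree). [cite: BalabanImbrieJaffe1988, (2.41) p.264] -/
theorem decay241_smallField (hj : j + 1 ≤ P.m + P.K) (U : GaugeField P j U1) {T δ σ : ℝ}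
    (hInt : ∀ b : PBond P j, blkIter 1 b.src = blkIter 1 b.tgt → ‖toC (U b) - 1‖ ≤ T)
    (hTree : ∀ x : Balaban1983to89.Site P j, ‖holCK U 1 x - 1‖ ≤ δ)
    (hσ : 2 * (((P.L : ℝ) - 1) * P.L) * P.d * T ^ 2 + 2 * δ ^ 2 ≤ σ)
    {Δ : Matrix (Balaban1983to89.Site P j) (Balaban1983to89.Site P j) ℂ} {Λ : Finset (Balaban1983to89.Site P j)} {γ E κ : ℝ}
    (hγ : 0 ≤ γ) (hκ : 0 ≤ κ) (hE : E < c240 P γ κ * (1 - σ))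
    (h238 : ∀ φ : Balaban1983to89.Site P j → ℂ, (∀ x ∉ Λ, φ x = 0) →
      γ * ∑ b : PBond P j, ‖toC (U b) * φ b.tgt - φ b.src‖ ^ 2 - E * ∑ x, ‖φ x‖ ^ 2 ≤ (star φ ⬝ᵥ (Δ *ᵥ φ)).re)
    {cΔ δ₀ θ : ℝ} (hcΔ : 0 ≤ cΔ) (hδ₀ : 0 < δ₀)
    (hker : ∀ x₁ ∈ Λ, ∀ x₂ ∈ Λ, ‖Δ x₁ x₂‖ ≤ cΔ * Real.exp (-(δ₀ * B5Ineq137Torus.T P j x₁ x₂)))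
    (hθ0 : 0 ≤ θ) (hθ : θ ≤ δ₀ / 4)
    (hsmall : θ * weightC (fun t => 2 * B4Sect5Proof.latticeConst P.d t)
        (cΔ + κ * (((P.L : ℝ) ^ P.d)⁻¹) ^ 2 * Real.exp (δ₀ * ((P.L : ℝ) - 1))) δ₀ ≤ (c240 P γ κ * (1 - σ) - E) / 2)
    (x₁ x₂ : ↥Λ) :
    ‖(compress Λ (op240 Δ κ U))⁻¹ x₁ x₂‖ ≤ 4 / (c240 P γ κ * (1 - σ) - E) * Real.exp (-(θ * B5Ineq137Torus.T P j x₁ x₂)) := by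
  have hρ : IsPseudoDist (fun a b : ↥Λ => B5Ineq137Torus.T P j a b) := (isPseudoDist_T P j).comp Subtype.val
  have hS : SumBound (fun a b : ↥Λ => B5Ineq137Torus.T P j a b) (B4Sect5Proof.latticeConst P.d) :=
    (sumBound_T P j).comp Subtype.val_injective
  have hc : 0 ≤ cΔ + κ * (((P.L : ℝ) ^ P.d)⁻¹) ^ 2 * Real.exp (δ₀ * ((P.L : ℝ) - 1)) := by positivity
  exact norm_inv_apply_le hρ hS (by linarith) hc hδ₀ hθ0 hθ (re_coercive_compress_smallField hj U hInt hTree hσ hγ hκ h238)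
    (fun a b => norm_op240_apply_le hj _ hκ hδ₀.le (hker a a.2 b b.2)) hsmall x₁ x₂

end Decay

/-! ## §3 The parameter scaling of `Δ_k(T,u)` and **the CONCRETE non-flat (2.38)-shape bound for gen 15's `Δ_k(T,u)`** at the [I] (4.5.4)
backgrounds `u = Q^{s*}_k v·e^{iθ}` — p33's (7.3.2)-with-mass-term BY NAME, read on the matrix through gen 16's dictionary -/

section Scaling

open BIJ88NeumannNoZeroModesTorus BIJ88NeumannPropagator227Torus

variable {P : Params} {j k : ℕ}

/-- kernel: the Neumann-cut covariant derivative is linear in its normalization constant: `(χ_ΩD_u)_{sc} = s·(χ_ΩD_u)_c`.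
[cite: BalabanImbrieJaffe1988, (5.6.10) p.287] -/
private theorem dN_smul (s c : ℝ) (U : GaugeField P j U1) (Ω : Finset (Balaban1983to89.Site P j)) :
    dN (s * c) U Ω = (s : ℂ) • dN c U Ω := by
  rw [dN, dN, ← Matrix.mul_smul]
  congr 1
  ext b x
  simp only [BIJ88Vj5610Operator.dMat, Matrix.of_apply, Matrix.smul_apply, smul_eq_mul, Complex.ofReal_mul]
  ring

/-- kernel: **`H_Ω(u)` is homogeneous of degree two in `(√a, c)`**: `nOp (s²a) (sc) = s²·nOp a c`. [cite: BalabanImbrieJaffe1988, (2.27) p.263] -/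
private theorem nOp_smul (s a c : ℝ) (U : GaugeField P j U1) (k : ℕ) (Ω : Finset (Balaban1983to89.Site P j)) :
    nOp (s ^ 2 * a) (s * c) U k Ω = ((s : ℂ) ^ 2) • nOp a c U k Ω := by
  rw [nOp_eq, nOp_eq, dN_smul, conjTranspose_smul, Matrix.smul_mul, Matrix.mul_smul, smul_smul, smul_add, smul_smul,
    Complex.star_def, Complex.conj_ofReal, Complex.ofReal_mul, Complex.ofReal_pow, sq]

/-- kernel: **the whole-torus propagator scales inversely**: `G_k(T,u)_{(s²a, sc)} = s^{−2}·G_k(T,u)_{(a,c)}` (`s ≠ 0`; both are the two-sided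
inverse of `H_T(u)`, gen 15's `gBox_univ_mul`). [cite: BalabanImbrieJaffe1988, (2.27) p.263] -/
theorem gBox_univ_smul (hk : j + k ≤ P.m + P.K) {s a c : ℝ} (hs : s ≠ 0) (hc : c ≠ 0) (ha : 0 < a) (U : GaugeField P j U1) :
    gBox (s ^ 2 * a) (s * c) U k univ = ((s : ℂ) ^ 2)⁻¹ • gBox a c U k univ := by
  have h1 := gBox_univ_mul hk hc ha U
  have hs2a : 0 < s ^ 2 * a := by positivity
  have h2 := gBox_univ_mul hk (mul_ne_zero hs hc) hs2a U
  have hs2 : ((s : ℂ) ^ 2) ≠ 0 := pow_ne_zero _ (Complex.ofReal_ne_zero.2 hs)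
  have h3 : (((s : ℂ) ^ 2)⁻¹ • gBox a c U k univ) * nOp (s ^ 2 * a) (s * c) U k univ = 1 := by
    rw [nOp_smul, Matrix.smul_mul, Matrix.mul_smul, smul_smul, inv_mul_cancel₀ hs2, one_smul, h1.1]
  calc gBox (s ^ 2 * a) (s * c) U k univ = (nOp (s ^ 2 * a) (s * c) U k univ)⁻¹ := (Matrix.inv_eq_left_inv h2.1).symm
    _ = _ := Matrix.inv_eq_left_inv h3

/-- **`Δ_k(T,u)` is homogeneous of degree two in `(√a, c)`**: `Δ_k(T,u)_{(s²a, sc)} = s²·Δ_k(T,u)_{(a,c)}` — whence gen 15's counting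
normalization `(A, ε^{−1}) = (s²a_k, s·c_phys)`, `s² = L^{kd}/(L^kε)²`, is `(A/a_k)×` the printed `Δ_k(u)` of [I] (4.6.4).
[cite: BalabanImbrieJaffe1988, (2.34) p.263] -/
theorem deltaRegion_univ_smul (hk : j + k ≤ P.m + P.K) {s a c : ℝ} (hs : s ≠ 0) (hc : c ≠ 0) (ha : 0 < a) (U : GaugeField P j U1) :
    deltaRegion (s ^ 2 * a) (s * c) U k univ = ((s : ℂ) ^ 2) • deltaRegion a c U k univ := by
  have hs2 : ((s : ℂ) ^ 2) ≠ 0 := pow_ne_zero _ (Complex.ofReal_ne_zero.2 hs)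
  rw [deltaRegion, deltaRegion, gBox_univ_smul hk hs hc ha U, Matrix.mul_smul, Matrix.smul_mul, smul_smul, smul_sub, smul_smul,
    smul_smul, Complex.ofReal_mul, Complex.ofReal_pow]
  congr 2
  field_simp

/-- kernel: the Hermitian form scales accordingly: `Re φᴴΔ_{(s²a,sc)}φ = s²·Re φᴴΔ_{(a,c)}φ`. [cite: BalabanImbrieJaffe1988, (2.34) p.263] -/
theorem re_form_deltaRegion_univ_smul (hk : j + k ≤ P.m + P.K) {s a c : ℝ} (hs : s ≠ 0) (hc : c ≠ 0) (ha : 0 < a) (U : GaugeField P j U1)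
    (φ : Balaban1983to89.Site P (j + k) → ℂ) :
    (star φ ⬝ᵥ (deltaRegion (s ^ 2 * a) (s * c) U k univ *ᵥ φ)).re = s ^ 2 * (star φ ⬝ᵥ (deltaRegion a c U k univ *ᵥ φ)).re := by
  rw [deltaRegion_univ_smul hk hs hc ha U, smul_mulVec, dotProduct_smul, smul_eq_mul, ← Complex.ofReal_pow, Complex.re_ofReal_mul]

end Scaling

section Concrete238

open BIJ85ScalarPropagatorTorus (FineSp)
open BIJ85ScalarForm464 (opT deltaOp)
open BIJ85Ineq732Flat (bondForm cPhys cPhys_pos cPhys_sq)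
open BIJ85Ineq732Background (bg454)
open BIJ85Ineq732BackgroundStab (ineq732_background_phys)
open BIJ88NeumannPropagatorWholeTorus (gLin opT_gLin inner_deltaOp_eq)
open BIJ85CoefficientAk464 (aK_eq_aSeq aK_pos_le)

variable {P : Params} {j k : ℕ}

/-- **THE NON-FLAT (2.38)-SHAPE BOUND FOR `Δ_k(T,u)` AT THE PRINTED NORMALIZATION** — [I] (7.3.2) with its field-strength term at the (4.5.4)
backgrounds `u = Q^{s*}_kv·e^{iθ}` (`|θ_b| ≤ T`, `36d(2d+1)²(L^kT)² ≤ 1`), p33's `ineq732_background_phys` BY NAME, read on gen 15's matrix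
`Δ_k(T,u) = deltaRegion a_k c_phys u k univ` through gen 16's `inner_deltaOp_eq` (right inverse `G := gLin`, `opT_gLin`):
`γ₀·Σ_B|v(B)φ(B₊) − φ(B₋)|² − 32γ₀·d(2d+1)²(L^kT)²·‖φ‖² ≤ Re φᴴΔ_k(T,u)φ`, `γ₀ = min(a/(10d), 1/5)`, for EVERY `φ` on `T^{(k)}` — in (2.38)'s words
*"⟨φ, Δ(u)φ⟩ ≥ c₁Σ_b|u(b)φ(b₊) − φ(b₋)|² − c·(field strength)²·Σ_x|φ(x)|²"* with the coarse bond field `v` on the unit lattice.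
[cite: BalabanImbrieJaffe1988, (2.38) p.264] -/
theorem ineq238_deltaRegion_phys (hk1 : 1 ≤ k) (hk : j + k ≤ P.m + P.K) {a : ℝ} (ha : 0 < a)
    (v : GaugeField P (j + k) U1) {θ : PBond P j → ℝ} {T : ℝ} (hT : 0 ≤ T) (hθ : ∀ b, |θ b| ≤ T)
    (hτ : 36 * P.d * (2 * P.d + 1) ^ 2 * ((P.L : ℝ) ^ k * T) ^ 2 ≤ 1) (φ : Balaban1983to89.Site P (j + k) → ℂ) :
    min (a / (10 * P.d)) (1 / 5) * ∑ B : PBond P (j + k), ‖toC (v B) * φ B.tgt - φ B.src‖ ^ 2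
        - 32 * min (a / (10 * P.d)) (1 / 5) * (P.d * (2 * P.d + 1) ^ 2 * ((P.L : ℝ) ^ k * T) ^ 2) * ∑ x, ‖φ x‖ ^ 2
      ≤ (star φ ⬝ᵥ (deltaRegion (BIJ85Sect4Statements.aK a P.L k) (cPhys P k) (bg454 k v θ) k univ *ᵥ φ)).re := by
  have haK := (aK_pos_le ha (B1RG242Torus.one_lt_cast_L P) hk1).1
  have hG : ∀ φ' : FineSp P j, opT (BIJ85ScalarPropagatorTorus.Dlin (cPhys P k) (bg454 k v θ)) (QlinK (bg454 k v θ) k)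
      (BIJ85Sect4Statements.aK a P.L k) (gLin (BIJ85Sect4Statements.aK a P.L k) (cPhys P k) (bg454 k v θ) k φ') = φ' :=
    fun φ' => (opT_gLin hk (cPhys_pos P k).ne' haK (bg454 k v θ) φ').1
  have h := ineq732_background_phys hk1 hk ha v hT hθ hτ hG (WithLp.toLp 2 φ)
  rw [inner_deltaOp_eq hk (cPhys_pos P k).ne' haK (bg454 k v θ) hG, WithLp.ofLp_toLp] at h
  exact h

/-- **THE NON-FLAT (2.38)-SHAPE BOUND FOR GEN 15's `Δ_k(T,u)` OF RECORD** (counting normalization `(A, ε^{−1})`, `A = α_k(a)L^{kd}`, on the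
`ε`-lattice `T^{(0)}`): at the [I] (4.5.4) backgrounds `u = Q^{s*}_kv·e^{iθ}` with `|θ_b| ≤ T`, `36d(2d+1)²(L^kT)² ≤ 1`, for EVERY `φ` on `T^{(k)}`,
`(A/a_k)·[γ₀·Σ_B|v(B)φ(B₊) − φ(B₋)|² − 32γ₀·d(2d+1)²(L^kT)²·‖φ‖²] ≤ Re φᴴΔ_k(T,u)φ` (`γ₀ = min(a/(10d), 1/5)`) — the shape of gen 18's flat
`ineq238_flat_mult` with the pure gauge `1^{h}` replaced by the small field `u` and the (2.35)-error by the (7.3.2) field-strength term; by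
`ineq238_deltaRegion_phys` and the degree-two homogeneity `deltaRegion_univ_smul` (`(A, ε^{−1}) = (s²a_k, s·c_phys)`, `s² = A/a_k`).
[cite: BalabanImbrieJaffe1988, (2.38) p.264] -/
theorem ineq238_deltaRegion_bg454 (hk1 : 1 ≤ k) (hk : 0 + k ≤ P.m + P.K) {a : ℝ} (ha : 0 < a)
    (v : GaugeField P (0 + k) U1) {θ : PBond P 0 → ℝ} {T : ℝ} (hT : 0 ≤ T) (hθ : ∀ b, |θ b| ≤ T)
    (hτ : 36 * P.d * (2 * P.d + 1) ^ 2 * ((P.L : ℝ) ^ k * T) ^ 2 ≤ 1) (φ : Balaban1983to89.Site P (0 + k) → ℂ) :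
    (B1RG242Torus.α P a k * (P.L : ℝ) ^ (k * P.d)) / B1.aSeq a P.L k *
        (min (a / (10 * P.d)) (1 / 5) * ∑ B : PBond P (0 + k), ‖toC (v B) * φ B.tgt - φ B.src‖ ^ 2
          - 32 * min (a / (10 * P.d)) (1 / 5) * (P.d * (2 * P.d + 1) ^ 2 * ((P.L : ℝ) ^ k * T) ^ 2) * ∑ x, ‖φ x‖ ^ 2)
      ≤ (star φ ⬝ᵥ (deltaRegion (B1RG242Torus.α P a k * (P.L : ℝ) ^ (k * P.d)) P.eps⁻¹ (bg454 k v θ) k univ *ᵥ φ)).re := by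
  have haK := (aK_pos_le ha (B1RG242Torus.one_lt_cast_L P) hk1).1
  have hcP := cPhys_pos P k
  have hε := P.eps_pos
  obtain ⟨s, hs⟩ : ∃ s : ℝ, s = P.eps⁻¹ / cPhys P k := ⟨_, rfl⟩
  have hs0 : 0 < s := by rw [hs]; positivity
  have e1 : s * cPhys P k = P.eps⁻¹ := by rw [hs, div_mul_cancel₀ _ hcP.ne']
  have e2 : s ^ 2 * BIJ85Sect4Statements.aK a P.L k = B1RG242Torus.α P a k * (P.L : ℝ) ^ (k * P.d) := by
    have hL : (0 : ℝ) < (P.L : ℝ) ^ k := pow_pos P.cast_L_pos _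
    have hLd : (0 : ℝ) < (P.L : ℝ) ^ (k * P.d) := pow_pos P.cast_L_pos _
    rw [hs, aK_eq_aSeq, B1RG242Torus.α, div_pow, inv_pow, cPhys_sq]
    unfold Params.spacing
    field_simp
  have e3 : B1RG242Torus.α P a k * (P.L : ℝ) ^ (k * P.d) / B1.aSeq a P.L k = s ^ 2 := by
    rw [← e2, aK_eq_aSeq, mul_div_assoc, div_self (B1.aSeq_pos ha (B1RG242Torus.one_lt_cast_L P) hk1).ne', mul_one]
  rw [e3, ← e2, ← e1, re_form_deltaRegion_univ_smul hk hs0.ne' hcP.ne' haK]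
  exact mul_le_mul_of_nonneg_left (ineq238_deltaRegion_phys hk1 hk ha v hT hθ hτ φ) (sq_nonneg s)

end Concrete238

/-! ## §4 **THE CONCRETE NON-FLAT (2.41) ON THE TORUS**: `C^{(k)}(T,u)|_Λ = [(Δ_k(T,u) + κQ(v)^*Q(v))|_Λ]^{−1}` at the [I] (4.5.4) small fields,
constants chosen BEFORE the instance -/

section Concrete241

open BIJ85AbelianStokes (plaqC)
open BIJ85Ineq732Background (bg454)
open BIJ88DeltaRegionSmallField236 (decay236_torus_smallField_level)

/-- kernel: `[y₁ = y₂] ≤ e^{−δ|y₁−y₂|}`. [folklore] -/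
private theorem ite_le_exp (P : Params) (j : ℕ) (δ : ℝ) (y₁ y₂ : Balaban1983to89.Site P j) :
    (if y₁ = y₂ then (1 : ℝ) else 0) ≤ Real.exp (-(δ * B5Ineq137Torus.T P j y₁ y₂)) := by
  split_ifs with h
  · rw [h, B5Ineq137Torus.T_self, mul_zero, neg_zero, Real.exp_zero]
  · exact (Real.exp_pos _).le

/-- **(2.41) AT THE SMALL NON-FLAT BACKGROUNDS OF [I] (4.5.4) FOR GEN 15's `Δ_k(T,u)`, constants chosen BEFORE the instance** (*"by (2.38),
C^{(k)}_Λ(u)^{−1} is bounded below and a random walk expansion as in [6] can be used to prove that |C^{(k)}_Λ(u; x₁, x₂)| ≦ ce^{−c|x₁−x₂|}.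
(2.41)"*, p. 264): for every `(d, L, a)` with `1 ≤ d ≤ 3`, `L` odd `> 1` (the scope of p27's (1.10) engine behind (2.36)) and `Q^*Q`-coefficient
`κ̂ > 0` there are `τ₀, δ₁, c₂ > 0` such that, on every torus of the model, at every level `1 ≤ k ≤ K` with a next lattice, for every background
`u = Q^{s*}_kv·e^{iθ}` (`bg454 k v θ`) with `|θ_b| ≤ T`, `(L^kT)² ≤ τ₀`, plaquettes `|u(∂p) − 1| ≤ θ_p`, `2d³(L^{2k}θ_p)² ≤ 1`, and coarse field `v`
with `|v(B) − 1| ≤ T₁` inside the `L`-blocks of `T^{(k)}`, holonomy deviation `≤ δ′`, `2(L−1)L·d·T₁² + 2δ′² ≤ ½`, and EVERY `Λ ⊆ T^{(k)}`, the propagator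
`C^{(k)}(T,u)|_Λ = [(Δ_k(T,u) + (A/a_k)κ̂·Q(v)^*Q(v))|_Λ]^{−1}` satisfies **`‖C(x₁,x₂)‖ ≤ (a_k/A)·c₂·e^{−δ₁|x₁−x₂|_{T^{(k)}}}`** for all `x₁, x₂ ∈ Λ` —
uniformly in `ε`, the torus, `k`, `Λ`, `v`, `θ` (`A/a_k = L^{kd}/(L^kε)² ≥ 1` is gen 15's counting normalization, carried by `Δ_k(T,u)`, `κ` and
`C^{−1}` alike).  Inputs BY NAME: §3 `ineq238_deltaRegion_bg454` (the non-flat (2.38)-shape, p33's (7.3.2)), gen 19's `decay236_torus_smallField_level`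
(the non-flat (2.36), p27's (1.10) at small plaquette fields), §1's small-field Poincaré step; engine §2 / `norm_inv_apply_le` ([6] Sect. 5 as
kernel-proved). [cite: BalabanImbrieJaffe1988, (2.41) p.264] -/
theorem decay241_deltaRegion_smallField (d L : ℕ) (hd : 1 ≤ d) (hd3 : d ≤ 3) (hL : Odd L ∧ 1 < L) {a : ℝ} (ha : 0 < a)
    {κ' : ℝ} (hκ' : 0 < κ') :
    ∃ τ₀ δ₁ c₂ : ℝ, 0 < τ₀ ∧ 0 < δ₁ ∧ 0 < c₂ ∧ ∀ (P : Params), P.d = d → P.L = L →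
      ∀ k : ℕ, 1 ≤ k → k ≤ P.K → k + 1 ≤ P.m + P.K →
      ∀ (v : GaugeField P (0 + k) U1) (θ : PBond P 0 → ℝ) (T : ℝ), 0 ≤ T → (∀ b, |θ b| ≤ T) →
        ((P.L : ℝ) ^ k * T) ^ 2 ≤ τ₀ →
      ∀ θp : ℝ, (∀ (y : Balaban1983to89.Site P 0) (μ ν : Fin P.d), ‖plaqC (bg454 k v θ) y μ ν - 1‖ ≤ θp) →
        2 * (P.d : ℝ) ^ 3 * (((P.L : ℝ) ^ k) ^ 2 * θp) ^ 2 ≤ 1 →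
      ∀ T₁ δ' : ℝ, (∀ B : PBond P (0 + k), blkIter 1 B.src = blkIter 1 B.tgt → ‖toC (v B) - 1‖ ≤ T₁) →
        (∀ x : Balaban1983to89.Site P (0 + k), ‖holCK v 1 x - 1‖ ≤ δ') →
        2 * (((P.L : ℝ) - 1) * P.L) * P.d * T₁ ^ 2 + 2 * δ' ^ 2 ≤ 1 / 2 →
      ∀ (Λ : Finset (Balaban1983to89.Site P (0 + k))) (x₁ x₂ : ↥Λ),
        ‖(compress Λ (op240 (deltaRegion (B1RG242Torus.α P a k * (P.L : ℝ) ^ (k * P.d)) P.eps⁻¹ (bg454 k v θ) k univ)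
            ((B1RG242Torus.α P a k * (P.L : ℝ) ^ (k * P.d)) / B1.aSeq a P.L k * κ') v))⁻¹ x₁ x₂‖ ≤
          ((B1RG242Torus.α P a k * (P.L : ℝ) ^ (k * P.d)) / B1.aSeq a P.L k)⁻¹ * c₂ *
            Real.exp (-(δ₁ * B5Ineq137Torus.T P (0 + k) x₁ x₂)) := by
  obtain ⟨δ₀, c₀, hδ₀, hc₀, H236⟩ := decay236_torus_smallField_level d L hd hd3 hL ha
  have hdr1 : (1 : ℝ) ≤ d := by exact_mod_cast hd
  have hL2 : 2 ≤ L := hL.2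
  have hLr2 : (2 : ℝ) ≤ L := by exact_mod_cast hL2
  -- the k-uniform constants (opaque abbreviations with their defining equations)
  obtain ⟨g0, hg0⟩ : ∃ x : ℝ, x = min (a / (10 * (d : ℝ))) (1 / 5) := ⟨_, rfl⟩
  obtain ⟨cS, hcS⟩ : ∃ x : ℝ, x = min (g0 / (2 * (((L : ℝ) - 1) * L))) (κ' / (2 * (L : ℝ) ^ d)) := ⟨_, rfl⟩
  obtain ⟨Z, hZ⟩ : ∃ x : ℝ, x = 32 * g0 * ((d : ℝ) * (2 * (d : ℝ) + 1) ^ 2) := ⟨_, rfl⟩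
  obtain ⟨τ₀, hτ₀⟩ : ∃ x : ℝ, x = min (1 / (36 * (d : ℝ) * (2 * (d : ℝ) + 1) ^ 2)) (cS / (4 * (Z + 1))) := ⟨_, rfl⟩
  obtain ⟨W, hW⟩ : ∃ x : ℝ, x = 4 / δ₀ * (2 * B4Sect5Proof.latticeConst d (δ₀ / 2)) := ⟨_, rfl⟩
  obtain ⟨c0T, hc0T⟩ : ∃ x : ℝ, x = a * (1 + a * c₀) + κ' * ((((L : ℝ) ^ d)⁻¹) ^ 2 * Real.exp (δ₀ * ((L : ℝ) - 1))) := ⟨_, rfl⟩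
  obtain ⟨θS, hθS⟩ : ∃ x : ℝ, x = min (δ₀ / 4) (cS / (8 * (c0T * W + 1))) := ⟨_, rfl⟩
  have hg00 : 0 < g0 := by rw [hg0]; exact lt_min (by positivity) (by norm_num)
  have hLL : (0 : ℝ) < 2 * (((L : ℝ) - 1) * L) := by nlinarith
  have hcS0 : 0 < cS := by rw [hcS]; exact lt_min (div_pos hg00 hLL) (by positivity)
  have hZ0 : 0 ≤ Z := by rw [hZ]; positivity
  have hτ₀0 : 0 < τ₀ := by rw [hτ₀]; exact lt_min (by positivity) (by positivity)
  have hW0 : 0 ≤ W := by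
    have := B4Sect5Proof.latticeConst_nonneg d (half_pos hδ₀).le
    rw [hW]; positivity
  have hc0T0 : 0 < c0T := by rw [hc0T]; positivity
  have hθS0 : 0 < θS := by rw [hθS]; exact lt_min (by positivity) (by positivity)
  have hθ4 : θS ≤ δ₀ / 4 := by rw [hθS]; exact min_le_left _ _
  have hθc : θS ≤ cS / (8 * (c0T * W + 1)) := by rw [hθS]; exact min_le_right _ _
  refine ⟨τ₀, θS, 16 / cS, hτ₀0, hθS0, by positivity, ?_⟩
  intro P hPd hPL k hk1 hkK hk' v θ T hT hθ hτ θp hplaq hθp T₁ δ' hInt hTree hσ Λ x₁ x₂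
  have hLr : (P.L : ℝ) = (L : ℝ) := by rw [hPL]
  have hdr : (P.d : ℝ) = (d : ℝ) := by rw [hPd]
  have hj : (0 + k) + 1 ≤ P.m + P.K := by rw [Nat.zero_add]; exact hk'
  have hk0 : 0 + k ≤ P.m + P.K := by rw [Nat.zero_add]; exact (Nat.le_succ k).trans hk'
  -- the two smallness consequences of `(L^kT)² ≤ τ₀`
  have hτa : ((P.L : ℝ) ^ k * T) ^ 2 ≤ 1 / (36 * (d : ℝ) * (2 * (d : ℝ) + 1) ^ 2) :=
    hτ.trans (by rw [hτ₀]; exact min_le_left _ _)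
  have hτb : ((P.L : ℝ) ^ k * T) ^ 2 ≤ cS / (4 * (Z + 1)) := hτ.trans (by rw [hτ₀]; exact min_le_right _ _)
  have hτ36 : 36 * P.d * (2 * P.d + 1) ^ 2 * ((P.L : ℝ) ^ k * T) ^ 2 ≤ 1 := by
    rw [hdr]
    have hpos : (0 : ℝ) < 36 * (d : ℝ) * (2 * (d : ℝ) + 1) ^ 2 := by positivity
    calc 36 * (d : ℝ) * (2 * (d : ℝ) + 1) ^ 2 * ((P.L : ℝ) ^ k * T) ^ 2
        ≤ 36 * (d : ℝ) * (2 * (d : ℝ) + 1) ^ 2 * (1 / (36 * (d : ℝ) * (2 * (d : ℝ) + 1) ^ 2)) := mul_le_mul_of_nonneg_left hτa hpos.le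
      _ = 1 := by field_simp
  -- the normalization constants
  have hak0 : 0 < B1.aSeq a P.L k := B1.aSeq_pos ha (B1RG242Torus.one_lt_cast_L P) hk1
  have hα : 0 < B1RG242Torus.α P a k := mul_pos hak0 (inv_pos.mpr (pow_pos (P.spacing_pos k) 2))
  have hA0 : 0 < B1RG242Torus.α P a k * (P.L : ℝ) ^ (k * P.d) := mul_pos hα (pow_pos P.cast_L_pos _)
  have hak_le' : B1.aSeq a P.L k ≤ a := B1.aSeq_le ha (B1RG242Torus.one_lt_cast_L P) k hk1
  -- the two printed inputs, raw
  have h238raw := fun φ => ineq238_deltaRegion_bg454 hk1 hk0 ha v hT hθ hτ36 φ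
  have h236raw := H236 P hPd hPL k hk1 hkK (bg454 k v θ) θp hplaq hθp
  clear H236
  obtain ⟨A, hAdef⟩ : ∃ x : ℝ, x = B1RG242Torus.α P a k * (P.L : ℝ) ^ (k * P.d) := ⟨_, rfl⟩
  obtain ⟨ak, hakdef⟩ : ∃ x : ℝ, x = B1.aSeq a P.L k := ⟨_, rfl⟩
  rw [← hAdef, ← hakdef] at h238raw h236raw ⊢
  rw [← hAdef] at hA0
  rw [← hakdef] at hak0 hak_le'
  obtain ⟨s, hsdef⟩ : ∃ x : ℝ, x = A / ak := ⟨_, rfl⟩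
  rw [← hsdef] at h238raw ⊢
  have hs0 : 0 < s := by rw [hsdef]; exact div_pos hA0 hak0
  have hsak : s * ak = A := by rw [hsdef]; field_simp
  -- the (2.38)-shape with `γ = s·g0`, `E = s·Z·τ²`
  obtain ⟨τ2, hτ2def⟩ : ∃ x : ℝ, x = ((P.L : ℝ) ^ k * T) ^ 2 := ⟨_, rfl⟩
  rw [← hτ2def] at hτb
  have hτ2n : 0 ≤ τ2 := by rw [hτ2def]; positivity
  obtain ⟨E, hE⟩ : ∃ x : ℝ, x = s * (Z * τ2) := ⟨_, rfl⟩
  have h238 : ∀ φ : Balaban1983to89.Site P (0 + k) → ℂ, (∀ x ∉ Λ, φ x = 0) →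
      s * g0 * ∑ B : PBond P (0 + k), ‖toC (v B) * φ B.tgt - φ B.src‖ ^ 2 - E * ∑ x, ‖φ x‖ ^ 2 ≤
        (star φ ⬝ᵥ (deltaRegion A P.eps⁻¹ (bg454 k v θ) k univ *ᵥ φ)).re := by
    intro φ _
    have h := h238raw φ
    rw [hdr, ← hg0, ← hτ2def] at h
    have e : s * (g0 * ∑ B : PBond P (0 + k), ‖toC (v B) * φ B.tgt - φ B.src‖ ^ 2
          - 32 * g0 * ((d : ℝ) * (2 * (d : ℝ) + 1) ^ 2 * τ2) * ∑ x, ‖φ x‖ ^ 2)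
        = s * g0 * ∑ B : PBond P (0 + k), ‖toC (v B) * φ B.tgt - φ B.src‖ ^ 2 - E * ∑ x, ‖φ x‖ ^ 2 := by
      rw [hE, hZ]; ring
    rw [← e]; exact h
  -- the Poincaré constant and the coercivity margin
  have hc240S : c240 P g0 κ' = cS := by rw [c240, hLr, hPd, hcS]
  have hcv : c240 P (s * g0) (s * κ') = s * cS := by rw [c240_smul P hs0.le, hc240S]
  have hEle : E ≤ s * cS / 4 := by
    have h1 : Z * τ2 ≤ cS / 4 := by
      have h2 : Z * τ2 ≤ Z * (cS / (4 * (Z + 1))) := mul_le_mul_of_nonneg_left hτb hZ0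
      have h3 : Z * (cS / (4 * (Z + 1))) ≤ cS / 4 := by
        rw [mul_div_assoc', div_le_div_iff₀ (by positivity) (by norm_num : (0 : ℝ) < 4)]
        have e4 : cS * (4 * (Z + 1)) = Z * cS * 4 + 4 * cS := by ring
        rw [e4]
        linarith only [hcS0.le]
      linarith only [h2, h3]
    rw [hE]
    have := mul_le_mul_of_nonneg_left h1 hs0.le
    linarith only [this]
  have hγco : s * cS / 4 ≤ c240 P (s * g0) (s * κ') * (1 - 1 / 2) - E := by rw [hcv]; linarith only [hEle]
  have hγco0 : 0 < s * cS / 4 := by positivity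
  have hElt : E < c240 P (s * g0) (s * κ') * (1 - 1 / 2) := by linarith only [hγco, hγco0]
  -- the kernel bound (2.36) at the small field
  obtain ⟨cΔ, hcΔ⟩ : ∃ x : ℝ, x = A * (1 + ak * c₀) := ⟨_, rfl⟩
  have hcΔ0 : 0 ≤ cΔ := by rw [hcΔ]; positivity
  have hker : ∀ y₁ ∈ Λ, ∀ y₂ ∈ Λ,
      ‖deltaRegion A P.eps⁻¹ (bg454 k v θ) k univ y₁ y₂‖ ≤ cΔ * Real.exp (-(δ₀ * B5Ineq137Torus.T P (0 + k) y₁ y₂)) := by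
    intro y₁ _ y₂ _
    refine (h236raw y₁ y₂).trans ?_
    have he := ite_le_exp P (0 + k) δ₀ y₁ y₂
    calc A * ((if y₁ = y₂ then 1 else 0) + ak * c₀ * Real.exp (-(δ₀ * B5Ineq137Torus.T P (0 + k) y₁ y₂)))
        ≤ A * (Real.exp (-(δ₀ * B5Ineq137Torus.T P (0 + k) y₁ y₂)) + ak * c₀ * Real.exp (-(δ₀ * B5Ineq137Torus.T P (0 + k) y₁ y₂))) :=
          mul_le_mul_of_nonneg_left (add_le_add he le_rfl) hA0.le
      _ = cΔ * Real.exp (-(δ₀ * B5Ineq137Torus.T P (0 + k) y₁ y₂)) := by rw [hcΔ]; ring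
  -- the smallness condition of the engine
  obtain ⟨ct, hct⟩ : ∃ x : ℝ, x = cΔ + s * κ' * (((P.L : ℝ) ^ P.d)⁻¹) ^ 2 * Real.exp (δ₀ * ((P.L : ℝ) - 1)) := ⟨_, rfl⟩
  have hct_le : ct ≤ s * c0T := by
    have h1 : cΔ = s * (ak * (1 + ak * c₀)) := by rw [hcΔ, ← hsak]; ring
    have h2 : ak * (1 + ak * c₀) ≤ a * (1 + a * c₀) := by
      have h22 : 0 ≤ 1 + ak * c₀ := by positivity
      calc ak * (1 + ak * c₀) ≤ a * (1 + ak * c₀) := mul_le_mul_of_nonneg_right hak_le' h22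
        _ ≤ a * (1 + a * c₀) := by gcongr
    have h3 : (((P.L : ℝ) ^ P.d)⁻¹) ^ 2 * Real.exp (δ₀ * ((P.L : ℝ) - 1)) = ((((L : ℝ) ^ d)⁻¹) ^ 2) * Real.exp (δ₀ * ((L : ℝ) - 1)) := by
      rw [hPd, hLr]
    have h4 : s * κ' * (((P.L : ℝ) ^ P.d)⁻¹) ^ 2 * Real.exp (δ₀ * ((P.L : ℝ) - 1)) =
        s * (κ' * (((((L : ℝ) ^ d)⁻¹) ^ 2) * Real.exp (δ₀ * ((L : ℝ) - 1)))) := by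
      rw [mul_assoc (s * κ'), h3, mul_assoc]
    rw [hct, h1, h4, hc0T, ← mul_add]
    exact mul_le_mul_of_nonneg_left (add_le_add h2 le_rfl) hs0.le
  have hwC : weightC (fun t => 2 * B4Sect5Proof.latticeConst P.d t) ct δ₀ = ct * W := by
    rw [B4Sect5Torus.weightC, hW, hPd]; ring
  have hct0 : 0 ≤ ct := by rw [hct]; positivity
  have hsmall : θS * weightC (fun t => 2 * B4Sect5Proof.latticeConst P.d t) ct δ₀ ≤ (c240 P (s * g0) (s * κ') * (1 - 1 / 2) - E) / 2 := by
    rw [hwC]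
    have h2 : θS * (ct * W) ≤ cS / (8 * (c0T * W + 1)) * (s * c0T * W) := by
      have : ct * W ≤ s * c0T * W := mul_le_mul_of_nonneg_right hct_le hW0
      exact mul_le_mul hθc this (by positivity) (by positivity)
    have h3 : cS / (8 * (c0T * W + 1)) * (s * c0T * W) ≤ s * cS / 8 := by
      have hden : 0 < 8 * (c0T * W + 1) := by positivity
      rw [div_mul_eq_mul_div, div_le_div_iff₀ hden (by norm_num : (0 : ℝ) < 8)]
      have e1 : cS * (s * c0T * W) * 8 = s * cS * (8 * (c0T * W + 1)) - 8 * (s * cS) := by ring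
      rw [e1]
      have h4 : 0 ≤ 8 * (s * cS) := by positivity
      linarith only [h4]
    linarith only [h2, h3, hγco]
  have hmain := decay241_smallField hj v hInt hTree hσ (mul_nonneg hs0.le hg00.le) (mul_nonneg hs0.le hκ'.le) hElt h238 hcΔ0 hδ₀ hker
    hθS0.le hθ4 (by rw [← hct]; exact hsmall) x₁ x₂
  refine hmain.trans ?_
  have he0 : 0 ≤ Real.exp (-(θS * B5Ineq137Torus.T P (0 + k) x₁ x₂)) := (Real.exp_pos _).le
  refine mul_le_mul_of_nonneg_right ?_ he0
  calc 4 / (c240 P (s * g0) (s * κ') * (1 - 1 / 2) - E) ≤ 4 / (s * cS / 4) := div_le_div_of_nonneg_left (by norm_num) hγco0 hγco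
    _ = s⁻¹ * (16 / cS) := by field_simp; ring

/-- **(2.41) VERBATIM SHAPE** `|C^{(k)}(u; x₁, x₂)| ≦ ce^{−c|x₁−x₂|}` at the small non-flat backgrounds of [I] (4.5.4) for gen 15's `Δ_k(T,u)`: the
bound of `decay241_deltaRegion_smallField` with the factor `(A/a_k)^{−1} ≤ 1` dropped (gen 19's `one_le_ratio`), same hypotheses, constants
depending on `(d, L, a, κ̂)` only. [cite: BalabanImbrieJaffe1988, (2.41) p.264] -/
theorem decay241_deltaRegion_smallField_printed (d L : ℕ) (hd : 1 ≤ d) (hd3 : d ≤ 3) (hL : Odd L ∧ 1 < L) {a : ℝ} (ha : 0 < a)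
    {κ' : ℝ} (hκ' : 0 < κ') :
    ∃ τ₀ δ₁ c₂ : ℝ, 0 < τ₀ ∧ 0 < δ₁ ∧ 0 < c₂ ∧ ∀ (P : Params), P.d = d → P.L = L →
      ∀ k : ℕ, 1 ≤ k → k ≤ P.K → k + 1 ≤ P.m + P.K →
      ∀ (v : GaugeField P (0 + k) U1) (θ : PBond P 0 → ℝ) (T : ℝ), 0 ≤ T → (∀ b, |θ b| ≤ T) →
        ((P.L : ℝ) ^ k * T) ^ 2 ≤ τ₀ →
      ∀ θp : ℝ, (∀ (y : Balaban1983to89.Site P 0) (μ ν : Fin P.d), ‖plaqC (bg454 k v θ) y μ ν - 1‖ ≤ θp) →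
        2 * (P.d : ℝ) ^ 3 * (((P.L : ℝ) ^ k) ^ 2 * θp) ^ 2 ≤ 1 →
      ∀ T₁ δ' : ℝ, (∀ B : PBond P (0 + k), blkIter 1 B.src = blkIter 1 B.tgt → ‖toC (v B) - 1‖ ≤ T₁) →
        (∀ x : Balaban1983to89.Site P (0 + k), ‖holCK v 1 x - 1‖ ≤ δ') →
        2 * (((P.L : ℝ) - 1) * P.L) * P.d * T₁ ^ 2 + 2 * δ' ^ 2 ≤ 1 / 2 →
      ∀ (Λ : Finset (Balaban1983to89.Site P (0 + k))) (x₁ x₂ : ↥Λ),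
        ‖(compress Λ (op240 (deltaRegion (B1RG242Torus.α P a k * (P.L : ℝ) ^ (k * P.d)) P.eps⁻¹ (bg454 k v θ) k univ)
            ((B1RG242Torus.α P a k * (P.L : ℝ) ^ (k * P.d)) / B1.aSeq a P.L k * κ') v))⁻¹ x₁ x₂‖ ≤
          c₂ * Real.exp (-(δ₁ * B5Ineq137Torus.T P (0 + k) x₁ x₂)) := by
  obtain ⟨τ₀, δ₁, c₂, hτ₀, hδ₁, hc₂, H⟩ := decay241_deltaRegion_smallField d L hd hd3 hL ha hκ'
  refine ⟨τ₀, δ₁, c₂, hτ₀, hδ₁, hc₂, ?_⟩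
  intro P hPd hPL k hk1 hkK hk' v θ T hT hθ hτ θp hplaq hθp T₁ δ' hInt hTree hσ Λ x₁ x₂
  refine (H P hPd hPL k hk1 hkK hk' v θ T hT hθ hτ θp hplaq hθp T₁ δ' hInt hTree hσ Λ x₁ x₂).trans ?_
  have hs : (B1RG242Torus.α P a k * (P.L : ℝ) ^ (k * P.d) / B1.aSeq a P.L k)⁻¹ ≤ 1 :=
    inv_le_one_of_one_le₀ (one_le_ratio P ha hk1 hkK)
  have he : 0 ≤ Real.exp (-(δ₁ * B5Ineq137Torus.T P (0 + k) x₁ x₂)) := (Real.exp_pos _).le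
  calc (B1RG242Torus.α P a k * (P.L : ℝ) ^ (k * P.d) / B1.aSeq a P.L k)⁻¹ * c₂ * Real.exp (-(δ₁ * B5Ineq137Torus.T P (0 + k) x₁ x₂))
      ≤ 1 * c₂ * Real.exp (-(δ₁ * B5Ineq137Torus.T P (0 + k) x₁ x₂)) :=
        mul_le_mul_of_nonneg_right (mul_le_mul_of_nonneg_right hs hc₂.le) he
    _ = c₂ * Real.exp (-(δ₁ * B5Ineq137Torus.T P (0 + k) x₁ x₂)) := by ring

end Concrete241

/-! ## §5 Gauge covariance: **(2.41) AT EVERY GAUGE TRANSFORM `u^h` of a small (4.5.4) background** — the propagator is conjugated by the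
diagonal unitary `M^{(k)}_h`, its kernel keeps its absolute values -/

section Gauge

open BIJ85AbelianStokes (plaqC)
open BIJ85Ineq732Background (bg454)
open BIJ88DeltaLoc234Torus (mulOp mulOpK conjTranspose_mul_mulOpK qMatT_gaugeAct deltaRegion_gaugeAct)
open BIJ88NeumannNoZeroModesTorus (isBlockUnion_univ)

variable {P : Params} {j : ℕ}

/-- kernel: **`P(v^{g}) = M_gP(v)M_gᴴ`** — (2.8) for the one-step average (gen 15's `qMatT_gaugeAct`) squared, `M^{(1)}_gᴴM^{(1)}_g = 1`.
[cite: BalabanImbrieJaffe1985, (2.8) p.303] -/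
theorem pOp_gaugeAct (hj : j + 1 ≤ P.m + P.K) (g : GaugeTransf P j U1) (v : GaugeField P j U1) :
    pOp (gaugeAct g v) = mulOp g * pOp v * (mulOp g)ᴴ := by
  rw [pOp, pOp, qMatT_gaugeAct hj, conjTranspose_mul, conjTranspose_mul, conjTranspose_conjTranspose]
  simp only [Matrix.mul_assoc]
  rw [← Matrix.mul_assoc ((mulOpK g 1)ᴴ), conjTranspose_mul_mulOpK, Matrix.one_mul]

/-- **(2.39)/(2.40) IS GAUGE COVARIANT**: `Δ_k(T,u^h) + κP(v^{h_k}) = M^{(k)}_h(Δ_k(T,u) + κP(v))M^{(k)}_hᴴ` with `h_k = h∘corner` the induced unit-lattice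
transformation (gen 15's `deltaRegion_gaugeAct` = [I] (6.3.2) on the torus, and `pOp_gaugeAct`). [cite: BalabanImbrieJaffe1988, (2.40) p.264] -/
theorem op240_deltaRegion_gaugeAct {k : ℕ} (hk : j + k ≤ P.m + P.K) (hk1 : j + k + 1 ≤ P.m + P.K) {a c : ℝ} (hc : c ≠ 0) (ha : 0 < a) (κ : ℝ)
    (h : GaugeTransf P j U1) (U : GaugeField P j U1) (v : GaugeField P (j + k) U1) :
    op240 (deltaRegion a c (gaugeAct h U) k univ) κ (gaugeAct (fun y => h (cornerIter k y)) v) =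
      mulOpK h k * op240 (deltaRegion a c U k univ) κ v * (mulOpK h k)ᴴ := by
  have e : mulOp (fun y => h (cornerIter k y)) = mulOpK h k := rfl
  rw [op240, op240, deltaRegion_gaugeAct hk hc ha h U (isBlockUnion_univ k), pOp_gaugeAct hk1, e, Matrix.mul_add, Matrix.add_mul,
    Matrix.mul_smul, Matrix.smul_mul]

section Sandwich

variable {S : Type*} [Fintype S] [DecidableEq S]

/-- kernel: restriction to `Λ` commutes with a diagonal conjugation. [folklore] -/
private theorem compress_sandwich (Λ : Finset S) (m : S → ℂ) (X : Matrix S S ℂ) :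
    compress Λ (diagonal m * X * (diagonal m)ᴴ) = diagonal (fun i : ↥Λ => m i) * compress Λ X * (diagonal (fun i : ↥Λ => m i))ᴴ := by
  ext i l
  simp only [compress, submatrix_apply, diagonal_conjTranspose, mul_diagonal, diagonal_mul, Pi.star_apply]

/-- kernel: **conjugation by a diagonal of phases preserves the absolute values of the entries of the inverse**:
`|(DYDᴴ)^{−1}(i,l)| = |Y^{−1}(i,l)|` for `|d_i| = 1`. [folklore] -/
private theorem norm_inv_sandwich_apply (m : S → ℂ) (hm : ∀ i, ‖m i‖ = 1) (Y : Matrix S S ℂ) (i l : S) :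
    ‖(diagonal m * Y * (diagonal m)ᴴ)⁻¹ i l‖ = ‖Y⁻¹ i l‖ := by
  have hmm : ∀ i, m i * (starRingEnd ℂ) (m i) = 1 := fun i => by
    rw [Complex.mul_conj, Complex.normSq_eq_norm_sq, hm, one_pow, Complex.ofReal_one]
  have h1 : (diagonal m)ᴴ * diagonal m = 1 := by
    rw [diagonal_conjTranspose, diagonal_mul_diagonal, ← diagonal_one]
    congr 1; funext i; rw [Pi.star_apply, Complex.star_def, mul_comm, hmm]
  have h2 : diagonal m * (diagonal m)ᴴ = 1 := by
    rw [diagonal_conjTranspose, diagonal_mul_diagonal, ← diagonal_one]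
    congr 1; funext i; rw [Pi.star_apply, Complex.star_def, hmm]
  have hinv : (diagonal m)⁻¹ = (diagonal m)ᴴ := Matrix.inv_eq_left_inv h1
  have hinv' : ((diagonal m)ᴴ)⁻¹ = diagonal m := Matrix.inv_eq_left_inv h2
  rw [Matrix.mul_inv_rev, Matrix.mul_inv_rev, hinv, hinv', ← Matrix.mul_assoc, diagonal_conjTranspose, mul_diagonal, diagonal_mul, norm_mul,
    norm_mul, Pi.star_apply, Complex.star_def, Complex.norm_conj, hm, hm, one_mul, mul_one]

end Sandwich

/-- **(2.41) AT EVERY GAUGE TRANSFORM `u^h = (Q^{s*}_kv·e^{iθ})^h` OF A SMALL (4.5.4) BACKGROUND** — the same constants `(τ₀, δ₁, c₂)` and hypotheses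
as `decay241_deltaRegion_smallField` (on `v`, `θ`, the plaquettes of `u` — all gauge invariant data), now for the propagator
`[(Δ_k(T,u^h) + (A/a_k)κ̂Q(v^{h_k})^*Q(v^{h_k}))|_Λ]^{−1}` at the transformed fine field `u^h` and unit-lattice field `v^{h_k}` (`h_k = h∘corner`), EVERY
`h : T_ε → U(1)`: **`‖C(x₁,x₂)‖ ≤ (a_k/A)·c₂·e^{−δ₁|x₁−x₂|_{T^{(k)}}}`** (`op240_deltaRegion_gaugeAct`: the operator is conjugated by the diagonal unitary
`M^{(k)}_h`, so is its inverse on `ℓ²(Λ)`, and the kernel keeps its absolute values). [cite: BalabanImbrieJaffe1988, (2.41) p.264] -/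
theorem decay241_deltaRegion_smallField_gaugeAct (d L : ℕ) (hd : 1 ≤ d) (hd3 : d ≤ 3) (hL : Odd L ∧ 1 < L) {a : ℝ} (ha : 0 < a)
    {κ' : ℝ} (hκ' : 0 < κ') :
    ∃ τ₀ δ₁ c₂ : ℝ, 0 < τ₀ ∧ 0 < δ₁ ∧ 0 < c₂ ∧ ∀ (P : Params), P.d = d → P.L = L →
      ∀ k : ℕ, 1 ≤ k → k ≤ P.K → k + 1 ≤ P.m + P.K →
      ∀ (v : GaugeField P (0 + k) U1) (θ : PBond P 0 → ℝ) (T : ℝ), 0 ≤ T → (∀ b, |θ b| ≤ T) →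
        ((P.L : ℝ) ^ k * T) ^ 2 ≤ τ₀ →
      ∀ θp : ℝ, (∀ (y : Balaban1983to89.Site P 0) (μ ν : Fin P.d), ‖plaqC (bg454 k v θ) y μ ν - 1‖ ≤ θp) →
        2 * (P.d : ℝ) ^ 3 * (((P.L : ℝ) ^ k) ^ 2 * θp) ^ 2 ≤ 1 →
      ∀ T₁ δ' : ℝ, (∀ B : PBond P (0 + k), blkIter 1 B.src = blkIter 1 B.tgt → ‖toC (v B) - 1‖ ≤ T₁) →
        (∀ x : Balaban1983to89.Site P (0 + k), ‖holCK v 1 x - 1‖ ≤ δ') →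
        2 * (((P.L : ℝ) - 1) * P.L) * P.d * T₁ ^ 2 + 2 * δ' ^ 2 ≤ 1 / 2 →
      ∀ (h : GaugeTransf P 0 U1) (Λ : Finset (Balaban1983to89.Site P (0 + k))) (x₁ x₂ : ↥Λ),
        ‖(compress Λ (op240 (deltaRegion (B1RG242Torus.α P a k * (P.L : ℝ) ^ (k * P.d)) P.eps⁻¹ (gaugeAct h (bg454 k v θ)) k univ)
            ((B1RG242Torus.α P a k * (P.L : ℝ) ^ (k * P.d)) / B1.aSeq a P.L k * κ')
            (gaugeAct (fun y => h (cornerIter k y)) v)))⁻¹ x₁ x₂‖ ≤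
          ((B1RG242Torus.α P a k * (P.L : ℝ) ^ (k * P.d)) / B1.aSeq a P.L k)⁻¹ * c₂ *
            Real.exp (-(δ₁ * B5Ineq137Torus.T P (0 + k) x₁ x₂)) := by
  obtain ⟨τ₀, δ₁, c₂, hτ₀, hδ₁, hc₂, H⟩ := decay241_deltaRegion_smallField d L hd hd3 hL ha hκ'
  refine ⟨τ₀, δ₁, c₂, hτ₀, hδ₁, hc₂, ?_⟩
  intro P hPd hPL k hk1 hkK hk' v θ T hT hθ hτ θp hplaq hθp T₁ δ' hInt hTree hσ h Λ x₁ x₂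
  have hk0 : 0 + k ≤ P.m + P.K := by rw [Nat.zero_add]; exact (Nat.le_succ k).trans hk'
  have hj : 0 + k + 1 ≤ P.m + P.K := by rw [Nat.zero_add]; exact hk'
  have hak0 : 0 < B1.aSeq a P.L k := B1.aSeq_pos ha (B1RG242Torus.one_lt_cast_L P) hk1
  have hα : 0 < B1RG242Torus.α P a k := mul_pos hak0 (inv_pos.mpr (pow_pos (P.spacing_pos k) 2))
  have hA0 : 0 < B1RG242Torus.α P a k * (P.L : ℝ) ^ (k * P.d) := mul_pos hα (pow_pos P.cast_L_pos _)
  have e : mulOpK h k = diagonal (fun y : Balaban1983to89.Site P (0 + k) => toC (h (cornerIter k y))) := rfl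
  rw [op240_deltaRegion_gaugeAct hk0 hj (inv_ne_zero P.eps_pos.ne') hA0, e, compress_sandwich,
    norm_inv_sandwich_apply _ (fun i => BIJ88Sect3Statements.norm_toC _)]
  exact H P hPd hPL k hk1 hkK hk' v θ T hT hθ hτ θp hplaq hθp T₁ δ' hInt hTree hσ Λ x₁ x₂

/-- **(2.41) VERBATIM SHAPE at every gauge transform of a small (4.5.4) background**: `‖C(x₁,x₂)‖ ≤ c₂·e^{−δ₁|x₁−x₂|_{T^{(k)}}}` for
`C = [(Δ_k(T,u^h) + (A/a_k)κ̂Q(v^{h_k})^*Q(v^{h_k}))|_Λ]^{−1}` (the factor `(A/a_k)^{−1} ≤ 1` of `decay241_deltaRegion_smallField_gaugeAct` dropped).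
[cite: BalabanImbrieJaffe1988, (2.41) p.264] -/
theorem decay241_deltaRegion_smallField_gaugeAct_printed (d L : ℕ) (hd : 1 ≤ d) (hd3 : d ≤ 3) (hL : Odd L ∧ 1 < L) {a : ℝ} (ha : 0 < a)
    {κ' : ℝ} (hκ' : 0 < κ') :
    ∃ τ₀ δ₁ c₂ : ℝ, 0 < τ₀ ∧ 0 < δ₁ ∧ 0 < c₂ ∧ ∀ (P : Params), P.d = d → P.L = L →
      ∀ k : ℕ, 1 ≤ k → k ≤ P.K → k + 1 ≤ P.m + P.K →
      ∀ (v : GaugeField P (0 + k) U1) (θ : PBond P 0 → ℝ) (T : ℝ), 0 ≤ T → (∀ b, |θ b| ≤ T) →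
        ((P.L : ℝ) ^ k * T) ^ 2 ≤ τ₀ →
      ∀ θp : ℝ, (∀ (y : Balaban1983to89.Site P 0) (μ ν : Fin P.d), ‖plaqC (bg454 k v θ) y μ ν - 1‖ ≤ θp) →
        2 * (P.d : ℝ) ^ 3 * (((P.L : ℝ) ^ k) ^ 2 * θp) ^ 2 ≤ 1 →
      ∀ T₁ δ' : ℝ, (∀ B : PBond P (0 + k), blkIter 1 B.src = blkIter 1 B.tgt → ‖toC (v B) - 1‖ ≤ T₁) →
        (∀ x : Balaban1983to89.Site P (0 + k), ‖holCK v 1 x - 1‖ ≤ δ') →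
        2 * (((P.L : ℝ) - 1) * P.L) * P.d * T₁ ^ 2 + 2 * δ' ^ 2 ≤ 1 / 2 →
      ∀ (h : GaugeTransf P 0 U1) (Λ : Finset (Balaban1983to89.Site P (0 + k))) (x₁ x₂ : ↥Λ),
        ‖(compress Λ (op240 (deltaRegion (B1RG242Torus.α P a k * (P.L : ℝ) ^ (k * P.d)) P.eps⁻¹ (gaugeAct h (bg454 k v θ)) k univ)
            ((B1RG242Torus.α P a k * (P.L : ℝ) ^ (k * P.d)) / B1.aSeq a P.L k * κ')
            (gaugeAct (fun y => h (cornerIter k y)) v)))⁻¹ x₁ x₂‖ ≤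
          c₂ * Real.exp (-(δ₁ * B5Ineq137Torus.T P (0 + k) x₁ x₂)) := by
  obtain ⟨τ₀, δ₁, c₂, hτ₀, hδ₁, hc₂, H⟩ := decay241_deltaRegion_smallField_gaugeAct d L hd hd3 hL ha hκ'
  refine ⟨τ₀, δ₁, c₂, hτ₀, hδ₁, hc₂, ?_⟩
  intro P hPd hPL k hk1 hkK hk' v θ T hT hθ hτ θp hplaq hθp T₁ δ' hInt hTree hσ h Λ x₁ x₂
  refine (H P hPd hPL k hk1 hkK hk' v θ T hT hθ hτ θp hplaq hθp T₁ δ' hInt hTree hσ h Λ x₁ x₂).trans ?_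
  have hs : (B1RG242Torus.α P a k * (P.L : ℝ) ^ (k * P.d) / B1.aSeq a P.L k)⁻¹ ≤ 1 :=
    inv_le_one_of_one_le₀ (one_le_ratio P ha hk1 hkK)
  have he : 0 ≤ Real.exp (-(δ₁ * B5Ineq137Torus.T P (0 + k) x₁ x₂)) := (Real.exp_pos _).le
  calc (B1RG242Torus.α P a k * (P.L : ℝ) ^ (k * P.d) / B1.aSeq a P.L k)⁻¹ * c₂ * Real.exp (-(δ₁ * B5Ineq137Torus.T P (0 + k) x₁ x₂))
      ≤ 1 * c₂ * Real.exp (-(δ₁ * B5Ineq137Torus.T P (0 + k) x₁ x₂)) :=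
        mul_le_mul_of_nonneg_right (mul_le_mul_of_nonneg_right hs hc₂.le) he
    _ = c₂ * Real.exp (-(δ₁ * B5Ineq137Torus.T P (0 + k) x₁ x₂)) := by ring

end Gauge

/-! ## §6 **(2.39)/(2.40) AT SMALL NON-FLAT FIELDS: `C^{(k)}(T,u)|_Λ` EXISTS** for gen 15's `Δ_k(T,u)` — any dimension, any `L`, every `Λ` -/

section Existence

open BIJ85Ineq732Background (bg454)

/-- **(2.39)/(2.40) AT THE SMALL (4.5.4) BACKGROUNDS: THE PROPAGATOR `[(Δ_k(T,u) + (A/a_k)κ̂Q(v)^*Q(v))|_Λ]^{−1}` EXISTS** (the compressed operator is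
invertible on `ℓ²(Λ)`), constants chosen BEFORE the instance and NO locality input: for every `(d, L, a, κ̂)` (`d ≥ 1`, `L ≥ 2` — no parity or
`d ≤ 3` restriction here) there is `τ₀ > 0` such that for every torus, `1 ≤ k ≤ K` with a next lattice, every `u = Q^{s*}_kv·e^{iθ}` with `|θ_b| ≤ T`,
`(L^kT)² ≤ τ₀`, coarse field `|v(B) − 1| ≤ T₁` inside the blocks, holonomy deviation `≤ δ′`, `2(L−1)L·d·T₁² + 2δ′² ≤ ½`, and EVERY `Λ ⊆ T^{(k)}`, the
operator `(Δ_k(T,u) + (A/a_k)κ̂Q(v)^*Q(v))|_Λ` is a unit — §3's non-flat (2.38)-shape + §1's `isUnit_compress_op240_smallField` (p. 264 *"by (2.38),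
C^{(k)}_Λ(u)^{−1} is bounded below"*). [cite: BalabanImbrieJaffe1988, (2.40) p.264] -/
theorem isUnit_op240_deltaRegion_smallField (d L : ℕ) (hd : 1 ≤ d) (hL2 : 2 ≤ L) {a : ℝ} (ha : 0 < a) {κ' : ℝ} (hκ' : 0 < κ') :
    ∃ τ₀ : ℝ, 0 < τ₀ ∧ ∀ (P : Params), P.d = d → P.L = L →
      ∀ k : ℕ, 1 ≤ k → k ≤ P.K → k + 1 ≤ P.m + P.K →
      ∀ (v : GaugeField P (0 + k) U1) (θ : PBond P 0 → ℝ) (T : ℝ), 0 ≤ T → (∀ b, |θ b| ≤ T) →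
        ((P.L : ℝ) ^ k * T) ^ 2 ≤ τ₀ →
      ∀ T₁ δ' : ℝ, (∀ B : PBond P (0 + k), blkIter 1 B.src = blkIter 1 B.tgt → ‖toC (v B) - 1‖ ≤ T₁) →
        (∀ x : Balaban1983to89.Site P (0 + k), ‖holCK v 1 x - 1‖ ≤ δ') →
        2 * (((P.L : ℝ) - 1) * P.L) * P.d * T₁ ^ 2 + 2 * δ' ^ 2 ≤ 1 / 2 →
      ∀ (Λ : Finset (Balaban1983to89.Site P (0 + k))),
        IsUnit (compress Λ (op240 (deltaRegion (B1RG242Torus.α P a k * (P.L : ℝ) ^ (k * P.d)) P.eps⁻¹ (bg454 k v θ) k univ)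
          ((B1RG242Torus.α P a k * (P.L : ℝ) ^ (k * P.d)) / B1.aSeq a P.L k * κ') v)) := by
  have hdr1 : (1 : ℝ) ≤ d := by exact_mod_cast hd
  have hLr2 : (2 : ℝ) ≤ L := by exact_mod_cast hL2
  obtain ⟨g0, hg0⟩ : ∃ x : ℝ, x = min (a / (10 * (d : ℝ))) (1 / 5) := ⟨_, rfl⟩
  obtain ⟨cS, hcS⟩ : ∃ x : ℝ, x = min (g0 / (2 * (((L : ℝ) - 1) * L))) (κ' / (2 * (L : ℝ) ^ d)) := ⟨_, rfl⟩
  obtain ⟨Z, hZ⟩ : ∃ x : ℝ, x = 32 * g0 * ((d : ℝ) * (2 * (d : ℝ) + 1) ^ 2) := ⟨_, rfl⟩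
  obtain ⟨τ₀, hτ₀⟩ : ∃ x : ℝ, x = min (1 / (36 * (d : ℝ) * (2 * (d : ℝ) + 1) ^ 2)) (cS / (4 * (Z + 1))) := ⟨_, rfl⟩
  have hg00 : 0 < g0 := by rw [hg0]; exact lt_min (by positivity) (by norm_num)
  have hLL : (0 : ℝ) < 2 * (((L : ℝ) - 1) * L) := by nlinarith
  have hcS0 : 0 < cS := by rw [hcS]; exact lt_min (div_pos hg00 hLL) (by positivity)
  have hZ0 : 0 ≤ Z := by rw [hZ]; positivity
  have hτ₀0 : 0 < τ₀ := by rw [hτ₀]; exact lt_min (by positivity) (by positivity)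
  refine ⟨τ₀, hτ₀0, ?_⟩
  intro P hPd hPL k hk1 hkK hk' v θ T hT hθ hτ T₁ δ' hInt hTree hσ Λ
  have hLr : (P.L : ℝ) = (L : ℝ) := by rw [hPL]
  have hdr : (P.d : ℝ) = (d : ℝ) := by rw [hPd]
  have hj : (0 + k) + 1 ≤ P.m + P.K := by rw [Nat.zero_add]; exact hk'
  have hk0 : 0 + k ≤ P.m + P.K := by rw [Nat.zero_add]; exact (Nat.le_succ k).trans hk'
  have hτa : ((P.L : ℝ) ^ k * T) ^ 2 ≤ 1 / (36 * (d : ℝ) * (2 * (d : ℝ) + 1) ^ 2) :=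
    hτ.trans (by rw [hτ₀]; exact min_le_left _ _)
  have hτb : ((P.L : ℝ) ^ k * T) ^ 2 ≤ cS / (4 * (Z + 1)) := hτ.trans (by rw [hτ₀]; exact min_le_right _ _)
  have hτ36 : 36 * P.d * (2 * P.d + 1) ^ 2 * ((P.L : ℝ) ^ k * T) ^ 2 ≤ 1 := by
    rw [hdr]
    have hpos : (0 : ℝ) < 36 * (d : ℝ) * (2 * (d : ℝ) + 1) ^ 2 := by positivity
    calc 36 * (d : ℝ) * (2 * (d : ℝ) + 1) ^ 2 * ((P.L : ℝ) ^ k * T) ^ 2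
        ≤ 36 * (d : ℝ) * (2 * (d : ℝ) + 1) ^ 2 * (1 / (36 * (d : ℝ) * (2 * (d : ℝ) + 1) ^ 2)) := mul_le_mul_of_nonneg_left hτa hpos.le
      _ = 1 := by field_simp
  have hak0 : 0 < B1.aSeq a P.L k := B1.aSeq_pos ha (B1RG242Torus.one_lt_cast_L P) hk1
  have hα : 0 < B1RG242Torus.α P a k := mul_pos hak0 (inv_pos.mpr (pow_pos (P.spacing_pos k) 2))
  have hA0 : 0 < B1RG242Torus.α P a k * (P.L : ℝ) ^ (k * P.d) := mul_pos hα (pow_pos P.cast_L_pos _)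
  have h238raw := fun φ => ineq238_deltaRegion_bg454 hk1 hk0 ha v hT hθ hτ36 φ
  obtain ⟨A, hAdef⟩ : ∃ x : ℝ, x = B1RG242Torus.α P a k * (P.L : ℝ) ^ (k * P.d) := ⟨_, rfl⟩
  obtain ⟨ak, hakdef⟩ : ∃ x : ℝ, x = B1.aSeq a P.L k := ⟨_, rfl⟩
  rw [← hAdef, ← hakdef] at h238raw ⊢
  rw [← hAdef] at hA0
  rw [← hakdef] at hak0
  obtain ⟨s, hsdef⟩ : ∃ x : ℝ, x = A / ak := ⟨_, rfl⟩
  rw [← hsdef] at h238raw ⊢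
  have hs0 : 0 < s := by rw [hsdef]; exact div_pos hA0 hak0
  obtain ⟨τ2, hτ2def⟩ : ∃ x : ℝ, x = ((P.L : ℝ) ^ k * T) ^ 2 := ⟨_, rfl⟩
  rw [← hτ2def] at hτb
  obtain ⟨E, hE⟩ : ∃ x : ℝ, x = s * (Z * τ2) := ⟨_, rfl⟩
  have h238 : ∀ φ : Balaban1983to89.Site P (0 + k) → ℂ, (∀ x ∉ Λ, φ x = 0) →
      s * g0 * ∑ B : PBond P (0 + k), ‖toC (v B) * φ B.tgt - φ B.src‖ ^ 2 - E * ∑ x, ‖φ x‖ ^ 2 ≤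
        (star φ ⬝ᵥ (deltaRegion A P.eps⁻¹ (bg454 k v θ) k univ *ᵥ φ)).re := by
    intro φ _
    have h := h238raw φ
    rw [hdr, ← hg0, ← hτ2def] at h
    have e : s * (g0 * ∑ B : PBond P (0 + k), ‖toC (v B) * φ B.tgt - φ B.src‖ ^ 2
          - 32 * g0 * ((d : ℝ) * (2 * (d : ℝ) + 1) ^ 2 * τ2) * ∑ x, ‖φ x‖ ^ 2)
        = s * g0 * ∑ B : PBond P (0 + k), ‖toC (v B) * φ B.tgt - φ B.src‖ ^ 2 - E * ∑ x, ‖φ x‖ ^ 2 := by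
      rw [hE, hZ]; ring
    rw [← e]; exact h
  have hc240S : c240 P g0 κ' = cS := by rw [c240, hLr, hPd, hcS]
  have hcv : c240 P (s * g0) (s * κ') = s * cS := by rw [c240_smul P hs0.le, hc240S]
  have hEle : E ≤ s * cS / 4 := by
    have h1 : Z * τ2 ≤ cS / 4 := by
      have h2 : Z * τ2 ≤ Z * (cS / (4 * (Z + 1))) := mul_le_mul_of_nonneg_left hτb hZ0
      have h3 : Z * (cS / (4 * (Z + 1))) ≤ cS / 4 := by
        rw [mul_div_assoc', div_le_div_iff₀ (by positivity) (by norm_num : (0 : ℝ) < 4)]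
        have e4 : cS * (4 * (Z + 1)) = Z * cS * 4 + 4 * cS := by ring
        rw [e4]
        linarith only [hcS0.le]
      linarith only [h2, h3]
    rw [hE]
    have := mul_le_mul_of_nonneg_left h1 hs0.le
    linarith only [this]
  have hsc : 0 < s * cS / 4 := by positivity
  have hElt : E < c240 P (s * g0) (s * κ') * (1 - 1 / 2) := by rw [hcv]; linarith only [hEle, hsc]
  exact isUnit_compress_op240_smallField hj v hInt hTree hσ (mul_nonneg hs0.le hg00.le) (mul_nonneg hs0.le hκ'.le) hElt h238

end Existence

/-! ## §7 (v1.2) **(4.9)_{j≥1} AT SMALL NON-FLAT FIELDS: THE REALIFIED PRECISION MATRIX `realify((Δ + κP(u))|_Λ)` IS POSITIVE DEFINITE AND THE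
GAUSSIAN INTEGRAL (4.9) HAS ITS CLOSED FORM** — r18's `Z49_eq` / `log_Z49_sites` with the hypothesis `T.PosDef` DISCHARGED at a small non-flat field
(gen 18's `BIJ88Eq240FlatTorus.Z49_flat_eq` / `Z49_deltaLocT_flat` are the case `u = 1^{h′}`; p34's `BIJ88BgInvariance416Torus.z49Slot_pureGauge_eq` reads the
flat one for the (5.9.6) slot object and records *"general small backgrounds: not addressed"* — this section is that case for `Δ_k(T,u)`) -/

section Z49SmallField

open BIJ88NeumannNoZeroModesTorus (IsBlockUnion isBlockUnion_univ)
open BIJ88NeumannPropagator227Torus (isUnit_nPad gBox_conjTranspose)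
open BIJ88Normalization46 (Z49 Z49_eq Z49_pos log_Z49_sites)
open BIJ85Ineq732Background (bg454)

variable {P : Params} {j : ℕ}

/-- **`Δ_k(Ω,u)` IS HERMITIAN** for every `U(1)` field `u`, every union `Ω` of `k`-blocks, `a > 0`, `c ≠ 0` (`Δ_k(Ω,u) = a − a²Q_k(u)G_k(Ω,u)Q_k(u)ᴴ` with
`G_k(Ω,u)ᴴ = G_k(Ω,u)`, gen 15's `gBox_conjTranspose`); in particular its quadratic form is real (gen 18's `BIJ85Ineq732FlatRegion.form_deltaRegion_im_eq_zero`).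
[cite: BalabanImbrieJaffe1988, (2.34)–(2.35) p.264] -/
theorem deltaRegion_conjTranspose {k : ℕ} (hk : j + k ≤ P.m + P.K) {a c : ℝ} (hc : c ≠ 0) (ha : 0 < a) (U : GaugeField P j U1)
    {Ω : Finset (Balaban1983to89.Site P j)} (hΩ : IsBlockUnion k Ω) : (deltaRegion a c U k Ω)ᴴ = deltaRegion a c U k Ω := by
  have h1 : star (a : ℂ) = a := Complex.conj_ofReal a
  have h2 : star ((a : ℂ) ^ 2) = (a : ℂ) ^ 2 := by rw [star_pow, h1]
  rw [deltaRegion, conjTranspose_sub, conjTranspose_smul, conjTranspose_smul, conjTranspose_one, conjTranspose_mul, conjTranspose_mul,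
    conjTranspose_conjTranspose, gBox_conjTranspose (isUnit_nPad hk hc ha U hΩ), ← Matrix.mul_assoc, h1, h2]

/-- **(4.9) AT A GENERAL STEP `j = k ≥ 1`, SMALL NON-FLAT `u`, EVALUATED** (*"Z^{(j)}_{Λ₁₀}(u_k) = ∫𝒟φ_{Λ₁₀} exp(−½⟨Λ₁₀φ,(Δ^{L^jη}_{j,loc}(u_k) +
aL^{−2}P(u_k))Λ₁₀φ⟩ − E^{(j)}_{k,s}|Λ₁₀|)"*, (4.9) p. 275; *"by (2.38), C^{(k)}_Λ(u)^{−1} is bounded below"*, p. 264): for any HERMITIAN `Δ` on `ℓ²(T^{(k)})`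
with the PRINTED (2.38)-shape bound `γΣ_b|u(b)φ(b₊) − φ(b₋)|² − E‖φ‖² ≤ Re φᴴΔφ` on the fields supported in `Λ`, at a bond field `u` with
`|u(b) − 1| ≤ T` inside the `L`-blocks, holonomy deviation `≤ δ`, `2(L−1)L·d·T² + 2δ² ≤ σ`, `κ ≥ 0`, `γ ≥ 0` and `E < c₀(γ,κ)(1 − σ)`, the precision matrix
`T = realify((Δ + κP(u))|_Λ)` of the Gaussian integral (4.9) (two real coordinates per site of `Λ`) is POSITIVE DEFINITE and
`Z = e^{−E_sN}·√(2π)^{2|Λ|}/√det T` — r18's `Z49_eq` with its hypothesis `T.PosDef` DISCHARGED at a small non-flat field (§1's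
`re_form_op240_smallField_pos` + gen 18's `realify_posDef`; gen 18's `Z49_flat_eq` is the case `T = δ = σ = 0`, `u = 1^{h′}`).
[cite: BalabanImbrieJaffe1988, (4.9) p.275] -/
theorem Z49_smallField_eq (hj : j + 1 ≤ P.m + P.K) (U : GaugeField P j U1) {T δ σ : ℝ}
    (hInt : ∀ b : PBond P j, blkIter 1 b.src = blkIter 1 b.tgt → ‖toC (U b) - 1‖ ≤ T)
    (hTree : ∀ x : Balaban1983to89.Site P j, ‖holCK U 1 x - 1‖ ≤ δ)
    (hσ : 2 * (((P.L : ℝ) - 1) * P.L) * P.d * T ^ 2 + 2 * δ ^ 2 ≤ σ)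
    {Δ : Matrix (Balaban1983to89.Site P j) (Balaban1983to89.Site P j) ℂ} (hΔ : Δ.IsHermitian) {Λ : Finset (Balaban1983to89.Site P j)}
    {γ E κ : ℝ} (hγ : 0 ≤ γ) (hκ : 0 ≤ κ) (hE : E < c240 P γ κ * (1 - σ))
    (h238 : ∀ φ : Balaban1983to89.Site P j → ℂ, (∀ x ∉ Λ, φ x = 0) →
      γ * ∑ b : PBond P j, ‖toC (U b) * φ b.tgt - φ b.src‖ ^ 2 - E * ∑ x, ‖φ x‖ ^ 2 ≤ (star φ ⬝ᵥ (Δ *ᵥ φ)).re) (Es N : ℝ) :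
    (realify (compress Λ (op240 Δ κ U))).PosDef ∧
      Z49 (realify (compress Λ (op240 Δ κ U))) Es N =
        Real.exp (-(Es * N)) * (Real.sqrt (2 * Real.pi) ^ Fintype.card (↥Λ × Fin 2) / Real.sqrt (realify (compress Λ (op240 Δ κ U))).det) := by
  have hH : (compress Λ (op240 Δ κ U)).IsHermitian := by
    show (compress Λ _)ᴴ = compress Λ _
    rw [compress, conjTranspose_submatrix, (op240_isHermitian hΔ κ _).eq]
  have hpos : ∀ v : ↥Λ → ℂ, v ≠ 0 → 0 < (star v ⬝ᵥ (compress Λ (op240 Δ κ U) *ᵥ v)).re := by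
    intro v hv
    rw [star_dotProduct_compress]
    exact re_form_op240_smallField_pos hj U hInt hTree hσ hγ hκ hE h238 (fun x hx => ext0_of_not_mem v hx)
      fun h0 => hv ((ext0_eq_zero_iff v).1 h0)
  have hT := realify_posDef hH hpos
  exact ⟨hT, Z49_eq _ hT Es N⟩

/-- … hence (4.9) is a POSITIVE number at a small non-flat field (r18's `Z49_pos`). [cite: BalabanImbrieJaffe1988, (4.9) p.275] -/
theorem Z49_smallField_pos (hj : j + 1 ≤ P.m + P.K) (U : GaugeField P j U1) {T δ σ : ℝ}
    (hInt : ∀ b : PBond P j, blkIter 1 b.src = blkIter 1 b.tgt → ‖toC (U b) - 1‖ ≤ T)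
    (hTree : ∀ x : Balaban1983to89.Site P j, ‖holCK U 1 x - 1‖ ≤ δ)
    (hσ : 2 * (((P.L : ℝ) - 1) * P.L) * P.d * T ^ 2 + 2 * δ ^ 2 ≤ σ)
    {Δ : Matrix (Balaban1983to89.Site P j) (Balaban1983to89.Site P j) ℂ} (hΔ : Δ.IsHermitian) {Λ : Finset (Balaban1983to89.Site P j)}
    {γ E κ : ℝ} (hγ : 0 ≤ γ) (hκ : 0 ≤ κ) (hE : E < c240 P γ κ * (1 - σ))
    (h238 : ∀ φ : Balaban1983to89.Site P j → ℂ, (∀ x ∉ Λ, φ x = 0) →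
      γ * ∑ b : PBond P j, ‖toC (U b) * φ b.tgt - φ b.src‖ ^ 2 - E * ∑ x, ‖φ x‖ ^ 2 ≤ (star φ ⬝ᵥ (Δ *ᵥ φ)).re) (Es N : ℝ) :
    0 < Z49 (realify (compress Λ (op240 Δ κ U))) Es N :=
  Z49_pos _ (Z49_smallField_eq hj U hInt hTree hσ hΔ hγ hκ hE h238 Es N).1 Es N

/-- **(4.9) in logarithmic form with (4.11) substituted**, at a general step and a small non-flat `u`: `log Z = |Λ|·((d−2)log(L^jη) + log 2π) − ½log det T`
(r18's `log_Z49_sites` with `T.PosDef` discharged, `|ι| = 2|Λ|`; gen 18's `log_Z49_flat_sites` is the flat case). [cite: BalabanImbrieJaffe1988, (4.9)–(4.11) p.275] -/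
theorem log_Z49_smallField_sites (hj : j + 1 ≤ P.m + P.K) (U : GaugeField P j U1) {T δ σ : ℝ}
    (hInt : ∀ b : PBond P j, blkIter 1 b.src = blkIter 1 b.tgt → ‖toC (U b) - 1‖ ≤ T)
    (hTree : ∀ x : Balaban1983to89.Site P j, ‖holCK U 1 x - 1‖ ≤ δ)
    (hσ : 2 * (((P.L : ℝ) - 1) * P.L) * P.d * T ^ 2 + 2 * δ ^ 2 ≤ σ)
    {Δ : Matrix (Balaban1983to89.Site P j) (Balaban1983to89.Site P j) ℂ} (hΔ : Δ.IsHermitian) {Λ : Finset (Balaban1983to89.Site P j)}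
    {γ E κ : ℝ} (hγ : 0 ≤ γ) (hκ : 0 ≤ κ) (hE : E < c240 P γ κ * (1 - σ))
    (h238 : ∀ φ : Balaban1983to89.Site P j → ℂ, (∀ x ∉ Λ, φ x = 0) →
      γ * ∑ b : PBond P j, ‖toC (U b) * φ b.tgt - φ b.src‖ ^ 2 - E * ∑ x, ‖φ x‖ ^ 2 ≤ (star φ ⬝ᵥ (Δ *ᵥ φ)).re) (d : ℕ) (Ljη : ℝ) :
    Real.log (Z49 (realify (compress Λ (op240 Δ κ U))) (BIJ88Sect4Statements.Eks d Ljη) Λ.card) =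
      (Λ.card : ℝ) * (((d : ℝ) - 2) * Real.log Ljη + Real.log (2 * Real.pi)) -
        (1 / 2 : ℝ) * Real.log (realify (compress Λ (op240 Δ κ U))).det := by
  have hT := (Z49_smallField_eq hj U hInt hTree hσ hΔ hγ hκ hE h238 0 0).1
  exact log_Z49_sites _ hT d Λ.card Ljη (by rw [card_idx, Fintype.card_coe])

/-- kernel (the data of §6 packaged): at the [I] (4.5.4) backgrounds `u = Q^{s*}_kv·e^{iθ}` with `(L^kT)² ≤ τ₀(d, L, a, κ̂)`, §3's non-flat (2.38)-shape bound
for gen 15's `Δ_k(T,u)` supplies constants `γ ≥ 0`, `E` with `E < c₀(γ, (A/a_k)κ̂)·(1 − ½)` — the hypotheses of §1/§7's abstract theorems with `σ = ½`.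
[cite: BalabanImbrieJaffe1988, (2.38) p.264] -/
private theorem bg454_package238 (d L : ℕ) (hd : 1 ≤ d) (hL2 : 2 ≤ L) {a : ℝ} (ha : 0 < a) {κ' : ℝ} (hκ' : 0 < κ') :
    ∃ τ₀ : ℝ, 0 < τ₀ ∧ ∀ (P : Params), P.d = d → P.L = L →
      ∀ k : ℕ, 1 ≤ k → k ≤ P.K → k + 1 ≤ P.m + P.K →
      ∀ (v : GaugeField P (0 + k) U1) (θ : PBond P 0 → ℝ) (T : ℝ), 0 ≤ T → (∀ b, |θ b| ≤ T) →
        ((P.L : ℝ) ^ k * T) ^ 2 ≤ τ₀ →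
      ∃ γ E : ℝ, 0 ≤ γ ∧ 0 ≤ (B1RG242Torus.α P a k * (P.L : ℝ) ^ (k * P.d)) / B1.aSeq a P.L k * κ' ∧
        E < c240 P γ ((B1RG242Torus.α P a k * (P.L : ℝ) ^ (k * P.d)) / B1.aSeq a P.L k * κ') * (1 - 1 / 2) ∧
        ∀ φ : Balaban1983to89.Site P (0 + k) → ℂ,
          γ * ∑ B : PBond P (0 + k), ‖toC (v B) * φ B.tgt - φ B.src‖ ^ 2 - E * ∑ x, ‖φ x‖ ^ 2 ≤
            (star φ ⬝ᵥ (deltaRegion (B1RG242Torus.α P a k * (P.L : ℝ) ^ (k * P.d)) P.eps⁻¹ (bg454 k v θ) k univ *ᵥ φ)).re := by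
  have hdr1 : (1 : ℝ) ≤ d := by exact_mod_cast hd
  have hLr2 : (2 : ℝ) ≤ L := by exact_mod_cast hL2
  obtain ⟨g0, hg0⟩ : ∃ x : ℝ, x = min (a / (10 * (d : ℝ))) (1 / 5) := ⟨_, rfl⟩
  obtain ⟨cS, hcS⟩ : ∃ x : ℝ, x = min (g0 / (2 * (((L : ℝ) - 1) * L))) (κ' / (2 * (L : ℝ) ^ d)) := ⟨_, rfl⟩
  obtain ⟨Z, hZ⟩ : ∃ x : ℝ, x = 32 * g0 * ((d : ℝ) * (2 * (d : ℝ) + 1) ^ 2) := ⟨_, rfl⟩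
  obtain ⟨τ₀, hτ₀⟩ : ∃ x : ℝ, x = min (1 / (36 * (d : ℝ) * (2 * (d : ℝ) + 1) ^ 2)) (cS / (4 * (Z + 1))) := ⟨_, rfl⟩
  have hg00 : 0 < g0 := by rw [hg0]; exact lt_min (by positivity) (by norm_num)
  have hLL : (0 : ℝ) < 2 * (((L : ℝ) - 1) * L) := by nlinarith
  have hcS0 : 0 < cS := by rw [hcS]; exact lt_min (div_pos hg00 hLL) (by positivity)
  have hZ0 : 0 ≤ Z := by rw [hZ]; positivity
  have hτ₀0 : 0 < τ₀ := by rw [hτ₀]; exact lt_min (by positivity) (by positivity)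
  refine ⟨τ₀, hτ₀0, ?_⟩
  intro P hPd hPL k hk1 hkK hk' v θ T hT hθ hτ
  have hLr : (P.L : ℝ) = (L : ℝ) := by rw [hPL]
  have hdr : (P.d : ℝ) = (d : ℝ) := by rw [hPd]
  have hk0 : 0 + k ≤ P.m + P.K := by rw [Nat.zero_add]; exact (Nat.le_succ k).trans hk'
  have hτa : ((P.L : ℝ) ^ k * T) ^ 2 ≤ 1 / (36 * (d : ℝ) * (2 * (d : ℝ) + 1) ^ 2) :=
    hτ.trans (by rw [hτ₀]; exact min_le_left _ _)
  have hτb : ((P.L : ℝ) ^ k * T) ^ 2 ≤ cS / (4 * (Z + 1)) := hτ.trans (by rw [hτ₀]; exact min_le_right _ _)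
  have hτ36 : 36 * P.d * (2 * P.d + 1) ^ 2 * ((P.L : ℝ) ^ k * T) ^ 2 ≤ 1 := by
    rw [hdr]
    have hpos : (0 : ℝ) < 36 * (d : ℝ) * (2 * (d : ℝ) + 1) ^ 2 := by positivity
    calc 36 * (d : ℝ) * (2 * (d : ℝ) + 1) ^ 2 * ((P.L : ℝ) ^ k * T) ^ 2
        ≤ 36 * (d : ℝ) * (2 * (d : ℝ) + 1) ^ 2 * (1 / (36 * (d : ℝ) * (2 * (d : ℝ) + 1) ^ 2)) := mul_le_mul_of_nonneg_left hτa hpos.le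
      _ = 1 := by field_simp
  have hak0 : 0 < B1.aSeq a P.L k := B1.aSeq_pos ha (B1RG242Torus.one_lt_cast_L P) hk1
  have hα : 0 < B1RG242Torus.α P a k := mul_pos hak0 (inv_pos.mpr (pow_pos (P.spacing_pos k) 2))
  have hA0 : 0 < B1RG242Torus.α P a k * (P.L : ℝ) ^ (k * P.d) := mul_pos hα (pow_pos P.cast_L_pos _)
  have h238raw := fun φ => ineq238_deltaRegion_bg454 hk1 hk0 ha v hT hθ hτ36 φ
  obtain ⟨A, hAdef⟩ : ∃ x : ℝ, x = B1RG242Torus.α P a k * (P.L : ℝ) ^ (k * P.d) := ⟨_, rfl⟩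
  obtain ⟨ak, hakdef⟩ : ∃ x : ℝ, x = B1.aSeq a P.L k := ⟨_, rfl⟩
  rw [← hAdef, ← hakdef] at h238raw ⊢
  rw [← hAdef] at hA0
  rw [← hakdef] at hak0
  obtain ⟨s, hsdef⟩ : ∃ x : ℝ, x = A / ak := ⟨_, rfl⟩
  rw [← hsdef] at h238raw ⊢
  have hs0 : 0 < s := by rw [hsdef]; exact div_pos hA0 hak0
  obtain ⟨τ2, hτ2def⟩ : ∃ x : ℝ, x = ((P.L : ℝ) ^ k * T) ^ 2 := ⟨_, rfl⟩
  rw [← hτ2def] at hτb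
  obtain ⟨E, hE⟩ : ∃ x : ℝ, x = s * (Z * τ2) := ⟨_, rfl⟩
  have h238 : ∀ φ : Balaban1983to89.Site P (0 + k) → ℂ,
      s * g0 * ∑ B : PBond P (0 + k), ‖toC (v B) * φ B.tgt - φ B.src‖ ^ 2 - E * ∑ x, ‖φ x‖ ^ 2 ≤
        (star φ ⬝ᵥ (deltaRegion A P.eps⁻¹ (bg454 k v θ) k univ *ᵥ φ)).re := by
    intro φ
    have h := h238raw φ
    rw [hdr, ← hg0, ← hτ2def] at h
    have e : s * (g0 * ∑ B : PBond P (0 + k), ‖toC (v B) * φ B.tgt - φ B.src‖ ^ 2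
          - 32 * g0 * ((d : ℝ) * (2 * (d : ℝ) + 1) ^ 2 * τ2) * ∑ x, ‖φ x‖ ^ 2)
        = s * g0 * ∑ B : PBond P (0 + k), ‖toC (v B) * φ B.tgt - φ B.src‖ ^ 2 - E * ∑ x, ‖φ x‖ ^ 2 := by
      rw [hE, hZ]; ring
    rw [← e]; exact h
  have hc240S : c240 P g0 κ' = cS := by rw [c240, hLr, hPd, hcS]
  have hcv : c240 P (s * g0) (s * κ') = s * cS := by rw [c240_smul P hs0.le, hc240S]
  have hEle : E ≤ s * cS / 4 := by
    have h1 : Z * τ2 ≤ cS / 4 := by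
      have h2 : Z * τ2 ≤ Z * (cS / (4 * (Z + 1))) := mul_le_mul_of_nonneg_left hτb hZ0
      have h3 : Z * (cS / (4 * (Z + 1))) ≤ cS / 4 := by
        rw [mul_div_assoc', div_le_div_iff₀ (by positivity) (by norm_num : (0 : ℝ) < 4)]
        have e4 : cS * (4 * (Z + 1)) = Z * cS * 4 + 4 * cS := by ring
        rw [e4]
        linarith only [hcS0.le]
      linarith only [h2, h3]
    rw [hE]
    have := mul_le_mul_of_nonneg_left h1 hs0.le
    linarith only [this]
  have hsc : 0 < s * cS / 4 := by positivity
  have hElt : E < c240 P (s * g0) (s * κ') * (1 - 1 / 2) := by rw [hcv]; linarith only [hEle, hsc]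
  exact ⟨s * g0, E, mul_nonneg hs0.le hg00.le, mul_nonneg hs0.le hκ'.le, hElt, h238⟩

/-- **(4.9)_{j≥1} AT THE SMALL (4.5.4) BACKGROUNDS FOR GEN 15's `Δ_k(T,u)`, EVALUATED — THE LOCATED NON-FLAT MEMBER** with `τ₀` chosen BEFORE the
instance: for every `(d, L, a, κ̂)` (`d ≥ 1`, `L ≥ 2`) there is `τ₀ > 0` such that for every torus, `1 ≤ k ≤ K` with a next lattice, every
`u = Q^{s*}_kv·e^{iθ}` with `|θ_b| ≤ T`, `(L^kT)² ≤ τ₀`, coarse field `|v(B) − 1| ≤ T₁` inside the blocks, holonomy deviation `≤ δ′`, `2(L−1)L·d·T₁² + 2δ′² ≤ ½`,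
EVERY `Λ ⊆ T^{(k)}` and every `(E_s, N)`: the precision matrix `T = realify((Δ_k(T,u) + (A/a_k)κ̂Q(v)^*Q(v))|_Λ)` is POSITIVE DEFINITE,
`Z^{(k)}_Λ(u) = e^{−E_sN}·√(2π)^{2|Λ|}/√det T` and `Z^{(k)}_Λ(u) > 0` — r18's (4.9) (`BIJ88Normalization46.Z49_eq`/`Z49_pos`) with `T.PosDef` DISCHARGED at a
small NON-FLAT background (the non-flat twin of gen 18's `Z49_deltaLocT_flat`; region form `Δ_k(T,u)`, `Ω = T`, no (2.35) localization — HONEST SCOPE (ii)).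
[cite: BalabanImbrieJaffe1988, (4.9) p.275] -/
theorem Z49_deltaRegion_smallField (d L : ℕ) (hd : 1 ≤ d) (hL2 : 2 ≤ L) {a : ℝ} (ha : 0 < a) {κ' : ℝ} (hκ' : 0 < κ') :
    ∃ τ₀ : ℝ, 0 < τ₀ ∧ ∀ (P : Params), P.d = d → P.L = L →
      ∀ k : ℕ, 1 ≤ k → k ≤ P.K → k + 1 ≤ P.m + P.K →
      ∀ (v : GaugeField P (0 + k) U1) (θ : PBond P 0 → ℝ) (T : ℝ), 0 ≤ T → (∀ b, |θ b| ≤ T) →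
        ((P.L : ℝ) ^ k * T) ^ 2 ≤ τ₀ →
      ∀ T₁ δ' : ℝ, (∀ B : PBond P (0 + k), blkIter 1 B.src = blkIter 1 B.tgt → ‖toC (v B) - 1‖ ≤ T₁) →
        (∀ x : Balaban1983to89.Site P (0 + k), ‖holCK v 1 x - 1‖ ≤ δ') →
        2 * (((P.L : ℝ) - 1) * P.L) * P.d * T₁ ^ 2 + 2 * δ' ^ 2 ≤ 1 / 2 →
      ∀ (Λ : Finset (Balaban1983to89.Site P (0 + k))) (Es N : ℝ),
        (realify (compress Λ (op240 (deltaRegion (B1RG242Torus.α P a k * (P.L : ℝ) ^ (k * P.d)) P.eps⁻¹ (bg454 k v θ) k univ)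
          ((B1RG242Torus.α P a k * (P.L : ℝ) ^ (k * P.d)) / B1.aSeq a P.L k * κ') v))).PosDef ∧
        Z49 (realify (compress Λ (op240 (deltaRegion (B1RG242Torus.α P a k * (P.L : ℝ) ^ (k * P.d)) P.eps⁻¹ (bg454 k v θ) k univ)
          ((B1RG242Torus.α P a k * (P.L : ℝ) ^ (k * P.d)) / B1.aSeq a P.L k * κ') v))) Es N =
          Real.exp (-(Es * N)) * (Real.sqrt (2 * Real.pi) ^ Fintype.card (↥Λ × Fin 2) /
            Real.sqrt (realify (compress Λ (op240 (deltaRegion (B1RG242Torus.α P a k * (P.L : ℝ) ^ (k * P.d)) P.eps⁻¹ (bg454 k v θ) k univ)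
              ((B1RG242Torus.α P a k * (P.L : ℝ) ^ (k * P.d)) / B1.aSeq a P.L k * κ') v))).det) ∧
        0 < Z49 (realify (compress Λ (op240 (deltaRegion (B1RG242Torus.α P a k * (P.L : ℝ) ^ (k * P.d)) P.eps⁻¹ (bg454 k v θ) k univ)
          ((B1RG242Torus.α P a k * (P.L : ℝ) ^ (k * P.d)) / B1.aSeq a P.L k * κ') v))) Es N := by
  obtain ⟨τ₀, hτ₀0, hpk⟩ := bg454_package238 d L hd hL2 ha hκ'
  refine ⟨τ₀, hτ₀0, ?_⟩
  intro P hPd hPL k hk1 hkK hk' v θ T hT hθ hτ T₁ δ' hInt hTree hσ Λ Es N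
  obtain ⟨γ, E, hγ, hκ, hE, h238⟩ := hpk P hPd hPL k hk1 hkK hk' v θ T hT hθ hτ
  have hj : (0 + k) + 1 ≤ P.m + P.K := by rw [Nat.zero_add]; exact hk'
  have hk0 : 0 + k ≤ P.m + P.K := by rw [Nat.zero_add]; exact (Nat.le_succ k).trans hk'
  have hak0 : 0 < B1.aSeq a P.L k := B1.aSeq_pos ha (B1RG242Torus.one_lt_cast_L P) hk1
  have hα : 0 < B1RG242Torus.α P a k := mul_pos hak0 (inv_pos.mpr (pow_pos (P.spacing_pos k) 2))
  have hA0 : 0 < B1RG242Torus.α P a k * (P.L : ℝ) ^ (k * P.d) := mul_pos hα (pow_pos P.cast_L_pos _)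
  have hΔ : (deltaRegion (B1RG242Torus.α P a k * (P.L : ℝ) ^ (k * P.d)) P.eps⁻¹ (bg454 k v θ) k univ).IsHermitian :=
    deltaRegion_conjTranspose hk0 (inv_ne_zero P.eps_pos.ne') hA0 _ (isBlockUnion_univ k)
  have h := Z49_smallField_eq (Λ := Λ) hj v hInt hTree hσ hΔ hγ hκ hE (fun φ _ => h238 φ) Es N
  exact ⟨h.1, h.2, Z49_pos _ h.1 Es N⟩

end Z49SmallField

end Literature.MathematicalPhysics.QuantumFieldTheory.BalabanImbrieJaffe1984to88.BIJ88Decay241SmallFieldTorus
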